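import Literature.Analysis.Complex.WeierstrassPreparation
import Literature.Geometry.Kaehler.AnalyticSet
import Mathlib.LinearAlgebra.Vandermonde
import Mathlib.LinearAlgebra.Matrix.ToLinearEquiv
import Mathlib.LinearAlgebra.FiniteDimensional.Lemmas
import Mathlib.Combinatorics.Pigeonhole
import HarnessLib

/-!
# Roots depending on parameters, elimination, and local analytic covers

Trunk support for the local theory of analytic sets (E. M. Chirka, *Complex Analytic Sets*,
Ch. 1 §§1.2–1.3, 3.1–3.7, 4.1–4.3), continuing `Literature/Analysis/Complex/WeierstrassPreparation.lean`
(the set-up `Literature.SCV.WeierstrassData f U' c r R`: `f (z', w)` holomorphic on `U' × {|w - c| < R}`,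
zero-free on the circles `{z'} × {|w - c| = r}`; `sliceRoots f c r z'` the zeros of `f (z', ·)` in
the disc, with multiplicity). Everything is local and stated in a complex normed space `E`
(parameters) times `ℂ` or `ℂᵐ = Fin m → ℂ` (fibre); no manifolds.

* **Roots depending holomorphically on parameters** (§1.2–1.3):
  `WeierstrassData.exists_separating_discs`, `….eventually_distinctRoots_le` (the number
  `distinctRoots` of distinct zeros is lower semicontinuous), `….exists_holomorphic_roots` (where
  it is maximal, the distinct zeros are holomorphic functions of the parameter, Chirka §1.2
  Prop. 2); the **discriminant set** via the Hankel determinant of the power sums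
  (`hankel`, `hankel_det_eq_zero_of_card_lt`, `hankel_det_ne_zero_of_card_eq`, `hankelDisc`,
  `WeierstrassData.exists_discriminant`, `….exists_discriminant_roots`): a holomorphic
  `μ ≢ 0` off whose zeros the zeros of the slices are locally the values of finitely many
  holomorphic functions with distinct values.
* **Elimination** (§3.2, with norms over the roots in place of resultants):
  `exists_equations_image_fst` (one fibre variable: the projection of the zero set of
  `f : E × ℂ → ℂᴺ` near a point with isolated fibre is the zero set of finitely many holomorphic
  functions, the norms `∏_ρ Σ_l t^l f_l (z', ρ)`; the "norm trick" `prod_sum_pow_mul_eq_zero_iff`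
  is pigeonhole + Vandermonde `eq_zero_of_sum_pow_mul_eq_zero`), `isZeroSetAt_image_fst`
  (`m` fibre variables, induction), `exists_shadow_equation` (the shadow of the zero set on a
  coordinate plane `(z', w_i)` lies in a hypersurface `F_i = 0` nontrivial on the slice).
  `IsZeroSetAt Z x` is the model-space form of "analytic at `x`"; it is provably equivalent
  to `Literature.IsAnalyticSetAt 𝓘(ℂ, E) Z x` (`isZeroSetAt_iff_isAnalyticSetAt`, the bridge to
  `Literature/Geometry/Kaehler/AnalyticSet.lean`; not a definitional equality, the manifold
  predicate using `MDifferentiableOn`).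
* **The local analytic cover** (§3.7, weak form): at a point `a = (a', a'')` with `a''`
  isolated in the fibre of the zero set `Z` of `f : E × ℂ^{m+1} → ℂᴺ`, `exists_coverSetup`
  produces a polydisc `ball a' ε × ball a'' r` over which `Z` is proper with finite fibres
  (`CoverSetup`, `CoverSetup.mem_ball_of_zero`, `….finite_zeros`), and
  `CoverSetup.exists_cover_structure` a holomorphic `Δ ≢ 0` on the base ball such that over a
  neighbourhood of every point where `Δ ≠ 0` the set `Z` is the disjoint union of the graphs of
  finitely many holomorphic maps (an unramified cover). The critical set is only located inside
  `{Δ = 0}` (Chirka proves it is analytic; that is not needed downstream). Ingredients: the Hankel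
  discriminants of the shadow functions, sheets (`Sheets`, `sheet`), the canonical local notion of
  a *full* sheet (`CoverSetup.Full`, constant along sheets by the identity theorem), the norms
  `CoverSetup.normFn` over the non-full points of the root boxes (`rootBox`), bounded hence
  extendable across `{∏ μ_i = 0}` by the Riemann extension theorem
  (`exists_differentiableOn_eqOn_of_thin`), and a common non-zero point of finitely many
  non-trivial holomorphic functions (`exists_forall_ne_zero_of_not_eventuallyEq`).

* **Closures of pieces of analytic covers are analytic** (§4.2–4.3, lite):
  `CoverPiece S V' G K R` (over the complement `G` of a thin subset of the open base `V'`, `S` is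
  locally the union of the graphs of at most `K` holomorphic maps with distinct values, with fibre
  coordinates bounded by `R`) and `CoverPiece.closure_inter_eq`: the closure of `S` in `V' × ℂⁿ`
  is the common zero set of finitely many functions holomorphic on `V' × ℂⁿ`, the Riemann
  extensions of the canonical defining functions `CoverPiece.defFn` built from the moment
  functionals `momentFn` (`Φ_t (z', w) = ∏_{b ∈ fibre z'} Σ_i t^i (w_i - b_i)`).

These are the inputs for the closure theorem for unions of components of the regular locus
(Chirka §5.1 Thm. (2), `Literature/Geometry/Kaehler/AnalyticSetComponents.lean`).

## References

* E. M. Chirka, *Complex Analytic Sets*, Kluwer (1989), Ch. 1 §1.2 (Prop. 1, 2; pp. 5–6),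
  §1.3 (discriminant set, pp. 7–8), §3.1–3.2 (proper projections, elimination; pp. 28–31),
  §3.4 Lemma 1, §3.7 Thm. (local analytic covers), §4.1–4.2 (analytic covers, canonical defining
  functions, Lemma 1–2; pp. 42–46), §4.3 Thm. (p. 47) [Chirka1989].
-/

open Complex Metric Set Filter Function
open scoped Topology Real Polynomial

namespace Literature.Analysis.Complex
namespace SCV


/-! ## Distinct roots, the discriminant locus, and holomorphic simple-root functions -/

section Discriminant

variable {E : Type*} [NormedAddCommGroup E] [NormedSpace ℂ E]
variable {f : E × ℂ → ℂ} {U' : Set E} {c : ℂ} {r R : ℝ}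

omit [NormedSpace ℂ E] in
/-- Continuity-compactness step: if `f` is continuous on an open set containing `{z₀} × sphere ρ₀ ε`
and does not vanish there, it does not vanish on `ball z₀ δ × sphere ρ₀ ε` for some `δ > 0`.
[folklore] -/
theorem exists_ball_forall_sphere_ne_zero {Ω : Set (E × ℂ)} (hΩ : IsOpen Ω)
    (hf : ContinuousOn f Ω) {z₀ : E} {ρ₀ : ℂ} {ε : ℝ}
    (hmem : ∀ w ∈ sphere ρ₀ ε, (z₀, w) ∈ Ω) (hne : ∀ w ∈ sphere ρ₀ ε, f (z₀, w) ≠ 0) :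
    ∃ δ > 0, ∀ z' ∈ ball z₀ δ, ∀ w ∈ sphere ρ₀ ε, (z', w) ∈ Ω ∧ f (z', w) ≠ 0 := by
  set N : Set (E × ℂ) := Ω ∩ f ⁻¹' {0}ᶜ with hN
  have hNo : IsOpen N := hf.isOpen_inter_preimage hΩ isOpen_compl_singleton
  have hK : ({z₀} : Set E) ×ˢ sphere ρ₀ ε ⊆ N := by
    rintro ⟨z, w⟩ ⟨hz, hw⟩
    rw [mem_singleton_iff] at hz
    subst hz
    exact ⟨hmem w hw, hne w hw⟩
  obtain ⟨V, T, hVo, -, hzV, hT, hVT⟩ :=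
    generalized_tube_lemma isCompact_singleton (isCompact_sphere ρ₀ ε) hNo hK
  obtain ⟨δ, hδ, hδV⟩ := Metric.isOpen_iff.1 hVo z₀ (hzV (mem_singleton z₀))
  exact ⟨δ, hδ, fun z' hz' w hw => hVT (mk_mem_prod (hδV hz') (hT hw))⟩

namespace WeierstrassData

/-- **Restriction to a sub-disc.** If `closedBall ρ₀ ε` lies in the disc `ball c r` and the slice
`f (z₀, ·)` has no zeros on the circle `sphere ρ₀ ε`, then near `z₀` the standing hypotheses hold
for the disc `ball ρ₀ ε` (so that the zeros inside it are again counted by a logarithmic residue).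
[Chirka, *Complex Analytic Sets*, §1.2–1.3] [folklore] -/
theorem exists_subdisc (hW : WeierstrassData f U' c r R) {z₀ : E} (hz₀ : z₀ ∈ U') {ρ₀ : ℂ}
    {ε : ℝ} (hε : 0 < ε) (hρε : dist ρ₀ c + ε < r)
    (hne : ∀ w ∈ sphere ρ₀ ε, f (z₀, w) ≠ 0) :
    ∃ δ > 0, ball z₀ δ ⊆ U' ∧ WeierstrassData f (ball z₀ δ) ρ₀ ε (R - dist ρ₀ c) := by
  have hsph : ∀ w ∈ sphere ρ₀ ε, (z₀, w) ∈ U' ×ˢ ball c R := fun w hw =>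
    mk_mem_prod hz₀ (mem_ball.2 (by
      calc dist w c ≤ dist w ρ₀ + dist ρ₀ c := dist_triangle _ _ _
        _ = ε + dist ρ₀ c := by rw [mem_sphere.1 hw]
        _ < R := by linarith [hW.lt]))
  obtain ⟨δ, hδ, hδne⟩ := exists_ball_forall_sphere_ne_zero hW.isOpen_prod
    hW.differentiableOn.continuousOn hsph hne
  obtain ⟨δ', hδ', hδ'U⟩ := Metric.isOpen_iff.1 hW.isOpen z₀ hz₀
  refine ⟨min δ δ', lt_min hδ hδ', (ball_subset_ball (min_le_right _ _)).trans hδ'U, ?_⟩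
  have hballs : ball ρ₀ (R - dist ρ₀ c) ⊆ ball c R := fun w hw => mem_ball.2 (by
    calc dist w c ≤ dist w ρ₀ + dist ρ₀ c := dist_triangle _ _ _
      _ < R := by rw [mem_ball] at hw; linarith)
  exact
    { isOpen := isOpen_ball
      pos := hε
      lt := by linarith [hW.lt]
      differentiableOn := hW.differentiableOn.mono (prod_mono
        ((ball_subset_ball (min_le_right _ _)).trans hδ'U) hballs)
      ne_zero := fun z' hz' w hw => (hδne z' (ball_subset_ball (min_le_left _ _) hz') w hw).2 }

open Classical in
/-- On a sub-disc inside `ball c r`, the root multiset of the sub-disc is the part of the root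
multiset of the big disc lying in the sub-disc. [folklore] -/
theorem filter_sliceRoots_eq (hW : WeierstrassData f U' c r R) {V : Set E} {ρ₀ : ℂ} {ε R' : ℝ}
    (hV : WeierstrassData f V ρ₀ ε R') (hVU : V ⊆ U') (hsub : ball ρ₀ ε ⊆ ball c r)
    {z' : E} (hz' : z' ∈ V) :
    (sliceRoots f c r z').filter (· ∈ ball ρ₀ ε) = sliceRoots f ρ₀ ε z' := by
  classical
  ext w
  rw [Multiset.count_filter]
  by_cases hw : w ∈ ball ρ₀ ε
  · rw [if_pos hw, sliceRoots, sliceRoots,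
      count_rootMultiset_of_mem_ball (hW.differentiableOn_slice (hVU hz')) hW.pos hW.lt
        (hW.ne_zero z' (hVU hz')) (hsub hw),
      count_rootMultiset_of_mem_ball (hV.differentiableOn_slice hz') hV.pos hV.lt
        (hV.ne_zero z' hz') hw]
  · rw [if_neg hw, eq_comm, Multiset.count_eq_zero]
    exact fun h => hw (mem_ball_of_mem_rootMultiset h)

end WeierstrassData

/-- The number of *distinct* zeros of the slice `f (z', ·)` in the disc. [folklore] -/
noncomputable def distinctRoots (f : E × ℂ → ℂ) (c : ℂ) (r : ℝ) (z' : E) : ℕ :=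
  (sliceRoots f c r z').toFinset.card

namespace WeierstrassData

/-- **Separating the distinct roots by small discs** (Chirka §1.2, proof of Prop. 2; §1.3): around
`z₀ ∈ U'` there is a ball on which, for each distinct root `ρ` of `f (z₀, ·)`, the standing
hypotheses hold for a small disc `ball ρ ε` (the same `ε` for all roots, the closed discs pairwise
disjoint and inside `ball c r`), and the number of roots in each small disc is constant.
[cite: Chirka1989, §1.3, p. 7] -/
theorem exists_separating_discs (hW : WeierstrassData f U' c r R) {z₀ : E} (hz₀ : z₀ ∈ U') :
    ∃ ε > 0, ∃ δ > 0, ball z₀ δ ⊆ U' ∧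
      (∀ ρ ∈ (sliceRoots f c r z₀).toFinset, dist ρ c + ε < r) ∧
      (∀ ρ ∈ (sliceRoots f c r z₀).toFinset, ∀ ρ' ∈ (sliceRoots f c r z₀).toFinset,
        ρ ≠ ρ' → 2 * ε < dist ρ ρ') ∧
      ∀ ρ ∈ (sliceRoots f c r z₀).toFinset,
        WeierstrassData f (ball z₀ δ) ρ ε (R - dist ρ c) ∧
        ∀ z' ∈ ball z₀ δ, (sliceRoots f ρ ε z').card = (sliceRoots f c r z₀).count ρ := by
  classical
  set S := (sliceRoots f c r z₀).toFinset with hS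
  have hg := hW.differentiableOn_slice hz₀
  have hSmem : ∀ ρ ∈ S, ρ ∈ ball c r ∧ f (z₀, ρ) = 0 := fun ρ hρ => by
    rw [hS, Multiset.mem_toFinset] at hρ
    exact (mem_rootMultiset_iff hg hW.pos hW.lt (hW.ne_zero z₀ hz₀)).1 hρ
  -- a radius `ε` smaller than half the mutual distances and the distances to the big circle
  obtain ⟨ε, hε, hε1, hε2⟩ : ∃ ε > 0, (∀ ρ ∈ S, dist ρ c + ε < r) ∧
      (∀ ρ ∈ S, ∀ ρ' ∈ S, ρ ≠ ρ' → 2 * ε < dist ρ ρ') := by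
    -- finitely many strict positivity constraints
    set gaps : Finset ℝ := (S.image fun ρ => r - dist ρ c) ∪
      ((S ×ˢ S).filter (fun p => p.1 ≠ p.2)).image (fun p => dist p.1 p.2 / 2) with hgaps
    have hpos : ∀ x ∈ gaps, 0 < x := by
      intro x hx
      rw [hgaps, Finset.mem_union, Finset.mem_image, Finset.mem_image] at hx
      rcases hx with ⟨ρ, hρ, rfl⟩ | ⟨p, hp, rfl⟩
      · have := mem_ball.1 (hSmem ρ hρ).1; linarith
      · rw [Finset.mem_filter] at hp
        exact half_pos (dist_pos.2 hp.2)
    obtain ⟨ε, hε, hεlt⟩ : ∃ ε > 0, ∀ x ∈ gaps, ε < x := by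
      by_cases hne : gaps.Nonempty
      · refine ⟨gaps.min' hne / 2, half_pos (hpos _ (Finset.min'_mem _ _)), fun x hx => ?_⟩
        exact (half_lt_self (hpos _ (Finset.min'_mem _ _))).trans_le (Finset.min'_le _ _ hx)
      · exact ⟨1, one_pos, fun x hx => absurd ⟨x, hx⟩ hne⟩
    refine ⟨ε, hε, fun ρ hρ => ?_, fun ρ hρ ρ' hρ' hne => ?_⟩
    · have : ε < r - dist ρ c := hεlt _ (by
        rw [hgaps, Finset.mem_union, Finset.mem_image]; exact Or.inl ⟨ρ, hρ, rfl⟩)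
      linarith
    · have : ε < dist ρ ρ' / 2 := hεlt _ (by
        rw [hgaps, Finset.mem_union]
        refine Or.inr (Finset.mem_image.2 ⟨(ρ, ρ'), ?_, rfl⟩)
        exact Finset.mem_filter.2 ⟨Finset.mk_mem_product hρ hρ', hne⟩)
      linarith
  -- the slice at `z₀` does not vanish on the small circles
  have hsph : ∀ ρ ∈ S, ∀ w ∈ sphere ρ ε, f (z₀, w) ≠ 0 := by
    intro ρ hρ w hw h0
    have hwr : w ∈ ball c r := mem_ball.2 (by
      calc dist w c ≤ dist w ρ + dist ρ c := dist_triangle _ _ _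
        _ = ε + dist ρ c := by rw [mem_sphere.1 hw]
        _ < r := by linarith [hε1 ρ hρ])
    have hwS : w ∈ S := by
      rw [hS, Multiset.mem_toFinset]
      exact (mem_rootMultiset_iff hg hW.pos hW.lt (hW.ne_zero z₀ hz₀)).2 ⟨hwr, h0⟩
    have hne : ρ ≠ w := by
      rintro rfl
      rw [mem_sphere, dist_self] at hw
      exact hε.ne' hw.symm
    have := hε2 ρ hρ w hwS hne
    rw [dist_comm, mem_sphere.1 hw] at this
    linarith
  -- sub-disc data around each root, on a common ball
  choose! δ hδ hδU hWδ using fun ρ (hρ : ρ ∈ S) =>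
    hW.exists_subdisc hz₀ hε (hε1 ρ hρ) (hsph ρ hρ)
  obtain ⟨δ₀, hδ₀, hδ₀U⟩ := Metric.isOpen_iff.1 hW.isOpen z₀ hz₀
  set δ' : ℝ := if hSne : S.Nonempty then min δ₀ (S.inf' hSne δ) else δ₀ with hδ'
  have hδ'pos : 0 < δ' := by
    rw [hδ']
    split_ifs with hSne
    · exact lt_min hδ₀ ((Finset.lt_inf'_iff hSne).2 fun ρ hρ => hδ ρ hρ)
    · exact hδ₀
  have hδ'le : ∀ ρ ∈ S, δ' ≤ δ ρ := by
    intro ρ hρ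
    rw [hδ', dif_pos ⟨ρ, hρ⟩]
    exact (min_le_right _ _).trans (Finset.inf'_le _ hρ)
  have hδ'U : ball z₀ δ' ⊆ U' := by
    refine (ball_subset_ball ?_).trans hδ₀U
    rw [hδ']
    split_ifs
    · exact min_le_left _ _
    · exact le_rfl
  refine ⟨ε, hε, δ', hδ'pos, hδ'U, hε1, hε2, fun ρ hρ => ?_⟩
  have hWρ : WeierstrassData f (ball z₀ δ') ρ ε (R - dist ρ c) :=
    (hWδ ρ hρ).mono isOpen_ball (ball_subset_ball (hδ'le ρ hρ))
  refine ⟨hWρ, fun z' hz' => ?_⟩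
  rw [hWρ.card_sliceRoots_eq (convex_ball z₀ δ').isPreconnected (mem_ball_self hδ'pos) hz']
  -- at `z₀` the small disc contains the single distinct root `ρ`
  have hsub : ball ρ ε ⊆ ball c r := fun w hw => mem_ball.2 (by
    calc dist w c ≤ dist w ρ + dist ρ c := dist_triangle _ _ _
      _ < ε + dist ρ c := by rw [mem_ball] at hw; linarith
      _ < r := by linarith [hε1 ρ hρ])
  rw [← hW.filter_sliceRoots_eq hWρ hδ'U hsub (mem_ball_self hδ'pos)]
  -- the filtered multiset is `count ρ • {ρ}`
  have : (sliceRoots f c r z₀).filter (· ∈ ball ρ ε) = (sliceRoots f c r z₀).filter (· = ρ) := by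
    refine Multiset.filter_congr fun w hw => ?_
    constructor
    · intro hwb
      by_contra hne
      have hwS : w ∈ S := by rw [hS, Multiset.mem_toFinset]; exact hw
      have := hε2 ρ hρ w hwS (Ne.symm hne)
      rw [mem_ball, dist_comm] at hwb
      linarith
    · rintro rfl; exact mem_ball_self hε
  rw [this, Multiset.filter_eq', Multiset.card_replicate]

end WeierstrassData

namespace WeierstrassData

/-- **Lower semicontinuity of the number of distinct roots**: near `z₀` every slice has at least
as many distinct zeros in the disc as `f (z₀, ·)` (each small disc around a root of `f (z₀, ·)`
keeps containing a root). [cite: Chirka1989, §1.3, p. 7] -/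
theorem eventually_distinctRoots_le (hW : WeierstrassData f U' c r R) {z₀ : E} (hz₀ : z₀ ∈ U') :
    ∃ δ > 0, ball z₀ δ ⊆ U' ∧ ∀ z' ∈ ball z₀ δ, distinctRoots f c r z₀ ≤ distinctRoots f c r z' := by
  classical
  obtain ⟨ε, hε, δ, hδ, hδU, hε1, hε2, hdisc⟩ := hW.exists_separating_discs hz₀
  refine ⟨δ, hδ, hδU, fun z' hz' => ?_⟩
  set S := (sliceRoots f c r z₀).toFinset with hS
  -- a root of `f (z', ·)` in each small disc
  have hex : ∀ ρ ∈ S, ∃ w ∈ sliceRoots f c r z', w ∈ ball ρ ε := by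
    intro ρ hρ
    obtain ⟨hWρ, hcard⟩ := hdisc ρ hρ
    have hpos : 0 < (sliceRoots f ρ ε z').card := by
      rw [hcard z' hz', Multiset.count_pos, ← Multiset.mem_toFinset]; exact hρ
    obtain ⟨w, hw⟩ := Multiset.card_pos_iff_exists_mem.1 hpos
    have hsub : ball ρ ε ⊆ ball c r := fun w hw => mem_ball.2 (by
      calc dist w c ≤ dist w ρ + dist ρ c := dist_triangle _ _ _
        _ < ε + dist ρ c := by rw [mem_ball] at hw; linarith
        _ < r := by linarith [hε1 ρ hρ])
    have hw' : w ∈ (sliceRoots f c r z').filter (· ∈ ball ρ ε) := by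
      rw [hW.filter_sliceRoots_eq hWρ hδU hsub hz']; exact hw
    rw [Multiset.mem_filter] at hw'
    exact ⟨w, hw'.1, hw'.2⟩
  choose! φ hφmem hφball using hex
  refine Finset.card_le_card_of_injOn φ (fun ρ hρ => ?_) fun ρ hρ ρ' hρ' heq => ?_
  · rw [Finset.mem_coe, Multiset.mem_toFinset]; exact hφmem ρ hρ
  · by_contra hne
    have h1 := hφball ρ hρ
    have h2 := hφball ρ' hρ'
    rw [heq] at h1
    rw [mem_ball] at h1 h2
    have := hε2 ρ hρ ρ' hρ' hne
    have := dist_triangle_left ρ ρ' (φ ρ')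
    linarith

/-- **Holomorphic root functions where the number of distinct roots is maximal** (Chirka §1.2
Prop. 2, local part; §1.3): if no slice has more distinct zeros in the disc than `f (z₀, ·)`, then
on a ball around `z₀` the distinct zeros of `f (z₀, ·)` continue to holomorphic functions
`α ρ` (`ρ` a root at `z₀`, `α ρ z₀ = ρ`) with pairwise distinct values, constant multiplicities
`m(ρ)`, and `roots (f (z', ·)) = Σ_ρ m(ρ) • {α ρ z'}`; each `α ρ` is an average of roots, hence
holomorphic by `differentiableOn_powerSum`. [cite: Chirka1989, §1.2 Prop. 1–2, p. 5–6] -/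
theorem exists_holomorphic_roots (hW : WeierstrassData f U' c r R) {z₀ : E} (hz₀ : z₀ ∈ U')
    (hmax : ∀ z' ∈ U', distinctRoots f c r z' ≤ distinctRoots f c r z₀) :
    ∃ δ > 0, ball z₀ δ ⊆ U' ∧ ∃ α : ℂ → E → ℂ,
      (∀ ρ ∈ (sliceRoots f c r z₀).toFinset, DifferentiableOn ℂ (α ρ) (ball z₀ δ)) ∧
      (∀ ρ ∈ (sliceRoots f c r z₀).toFinset, α ρ z₀ = ρ) ∧
      (∀ z' ∈ ball z₀ δ, ∀ ρ ∈ (sliceRoots f c r z₀).toFinset, α ρ z' ∈ ball c r) ∧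
      (∀ z' ∈ ball z₀ δ, ∀ ρ ∈ (sliceRoots f c r z₀).toFinset,
        ∀ ρ' ∈ (sliceRoots f c r z₀).toFinset, ρ ≠ ρ' → α ρ z' ≠ α ρ' z') ∧
      (∀ z' ∈ ball z₀ δ, sliceRoots f c r z' =
        ∑ ρ ∈ (sliceRoots f c r z₀).toFinset, (sliceRoots f c r z₀).count ρ • {α ρ z'}) := by
  classical
  obtain ⟨ε, hε, δ, hδ, hδU, hε1, hε2, hdisc⟩ := hW.exists_separating_discs hz₀
  set S := (sliceRoots f c r z₀).toFinset with hS
  have hsubρ : ∀ ρ ∈ S, ball ρ ε ⊆ ball c r := fun ρ hρ w hw => mem_ball.2 (by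
    calc dist w c ≤ dist w ρ + dist ρ c := dist_triangle _ _ _
      _ < ε + dist ρ c := by rw [mem_ball] at hw; linarith
      _ < r := by linarith [hε1 ρ hρ])
  -- Step 1: for `z'` in the ball, every root lies in one of the small discs, and each small
  -- disc contains exactly one distinct root.
  have key : ∀ z' ∈ ball z₀ δ, ∀ w ∈ sliceRoots f c r z', ∃ ρ ∈ S, w ∈ ball ρ ε := by
    intro z' hz'
    -- the injection `φ : S → roots(z')` of the previous proof is onto, by maximality
    have hex : ∀ ρ ∈ S, ∃ w ∈ sliceRoots f c r z', w ∈ ball ρ ε := by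
      intro ρ hρ
      obtain ⟨hWρ, hcard⟩ := hdisc ρ hρ
      have hpos : 0 < (sliceRoots f ρ ε z').card := by
        rw [hcard z' hz', Multiset.count_pos, ← Multiset.mem_toFinset]; exact hρ
      obtain ⟨w, hw⟩ := Multiset.card_pos_iff_exists_mem.1 hpos
      have hw' : w ∈ (sliceRoots f c r z').filter (· ∈ ball ρ ε) := by
        rw [hW.filter_sliceRoots_eq hWρ hδU (hsubρ ρ hρ) hz']; exact hw
      rw [Multiset.mem_filter] at hw'
      exact ⟨w, hw'.1, hw'.2⟩
    choose! φ hφmem hφball using hex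
    have hmaps : Set.MapsTo φ S (sliceRoots f c r z').toFinset := fun ρ hρ => by
      rw [Finset.mem_coe, Multiset.mem_toFinset]; exact hφmem ρ hρ
    have hinj : Set.InjOn φ S := by
      intro ρ hρ ρ' hρ' heq
      by_contra hne
      have h1 := hφball ρ hρ
      have h2 := hφball ρ' hρ'
      rw [heq] at h1
      rw [mem_ball] at h1 h2
      have := hε2 ρ hρ ρ' hρ' hne
      have := dist_triangle_left ρ ρ' (φ ρ')
      linarith
    have hcardT : (sliceRoots f c r z').toFinset.card ≤ S.card := hmax z' (hδU hz')
    have hsurj : Set.SurjOn φ S (sliceRoots f c r z').toFinset :=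
      Finset.surjOn_of_injOn_of_card_le φ hmaps hinj hcardT
    intro w hw
    obtain ⟨ρ, hρ, rfl⟩ := hsurj (by rw [Finset.mem_coe, Multiset.mem_toFinset]; exact hw)
    exact ⟨ρ, hρ, hφball ρ hρ⟩
  have uniq : ∀ z' ∈ ball z₀ δ, ∀ ρ ∈ S, ∀ w ∈ sliceRoots f ρ ε z', ∀ w' ∈ sliceRoots f ρ ε z',
      w = w' := by
    intro z' hz' ρ hρ w hw w' hw'
    -- both are roots of the big disc lying in `ball ρ ε`; count distinct roots
    obtain ⟨hWρ, hcard⟩ := hdisc ρ hρ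
    have hfilt := hW.filter_sliceRoots_eq hWρ hδU (hsubρ ρ hρ) hz'
    have hw1 : w ∈ (sliceRoots f c r z').filter (· ∈ ball ρ ε) := by rw [hfilt]; exact hw
    have hw1' : w' ∈ (sliceRoots f c r z').filter (· ∈ ball ρ ε) := by rw [hfilt]; exact hw'
    rw [Multiset.mem_filter] at hw1 hw1'
    by_contra hne
    -- then `roots(z')` has at least `|S| + 1` distinct elements: contradiction with maximality
    have hwT : w ∈ (sliceRoots f c r z').toFinset := Multiset.mem_toFinset.2 hw1.1
    have hw'T : w' ∈ (sliceRoots f c r z').toFinset := Multiset.mem_toFinset.2 hw1'.1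
    -- restrict `ψ` to `T.erase w'`: still onto `S`? Rather: `ψ` restricted to `T.erase w` is
    -- injective into `S`... Simplest: the fibre of `ψ` over `ρ` has ≥ 2 elements, so
    -- `|T| ≥ |S| + 1` by counting fibres.
    have hcount : S.card + 1 ≤ (sliceRoots f c r z').toFinset.card := by
      set T := (sliceRoots f c r z').toFinset with hT
      -- injection from `S` into `T.erase w'` : send `ρ' ↦` a root in its disc, choosing `w` for `ρ`
      have hex : ∀ ρ' ∈ S, ∃ u ∈ T.erase w', u ∈ ball ρ' ε := by
        intro ρ' hρ'
        by_cases hρρ : ρ' = ρ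
        · subst hρρ
          refine ⟨w, Finset.mem_erase.2 ⟨hne, hwT⟩, hw1.2⟩
        · obtain ⟨hWρ', hcard'⟩ := hdisc ρ' hρ'
          have hpos : 0 < (sliceRoots f ρ' ε z').card := by
            rw [hcard' z' hz', Multiset.count_pos, ← Multiset.mem_toFinset]; exact hρ'
          obtain ⟨u, hu⟩ := Multiset.card_pos_iff_exists_mem.1 hpos
          have hu' : u ∈ (sliceRoots f c r z').filter (· ∈ ball ρ' ε) := by
            rw [hW.filter_sliceRoots_eq hWρ' hδU (hsubρ ρ' hρ') hz']; exact hu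
          rw [Multiset.mem_filter] at hu'
          refine ⟨u, Finset.mem_erase.2 ⟨?_, Multiset.mem_toFinset.2 hu'.1⟩, hu'.2⟩
          rintro rfl
          -- `w' ∈ ball ρ ε ∩ ball ρ' ε` with `ρ ≠ ρ'`
          have h1 := hu'.2
          have h2 := hw1'.2
          rw [mem_ball] at h1 h2
          have := hε2 ρ' hρ' ρ hρ hρρ
          have := dist_triangle_left ρ' ρ u
          linarith
      choose! χ hχmem hχball using hex
      have hmaps : Set.MapsTo χ S (T.erase w') := fun ρ' hρ' => hχmem ρ' hρ'
      have hinj : Set.InjOn χ S := by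
        intro ρ₁ h₁ ρ₂ h₂ heq
        by_contra hne12
        have h1 := hχball ρ₁ h₁
        have h2 := hχball ρ₂ h₂
        rw [heq] at h1
        rw [mem_ball] at h1 h2
        have := hε2 ρ₁ h₁ ρ₂ h₂ hne12
        have := dist_triangle_left ρ₁ ρ₂ (χ ρ₂)
        linarith
      have := Finset.card_le_card_of_injOn χ hmaps hinj
      rw [Finset.card_erase_of_mem hw'T] at this
      have hTpos : 0 < T.card := Finset.card_pos.2 ⟨w', hw'T⟩
      omega
    have := hmax z' (hδU hz')
    simp only [distinctRoots] at this
    rw [← hS] at this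
    omega
  -- Step 2: the root functions
  set α : ℂ → E → ℂ := fun ρ z' =>
    ((sliceRoots f c r z₀).count ρ : ℂ)⁻¹ * ((sliceRoots f ρ ε z').map (· ^ 1)).sum with hα
  have hrep : ∀ z' ∈ ball z₀ δ, ∀ ρ ∈ S,
      sliceRoots f ρ ε z' = Multiset.replicate ((sliceRoots f c r z₀).count ρ) (α ρ z') := by
    intro z' hz' ρ hρ
    obtain ⟨hWρ, hcard⟩ := hdisc ρ hρ
    have hk : 0 < (sliceRoots f c r z₀).count ρ := by
      rw [Multiset.count_pos, ← Multiset.mem_toFinset]; exact hρ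
    have hpos : 0 < (sliceRoots f ρ ε z').card := by rw [hcard z' hz']; exact hk
    obtain ⟨w, hw⟩ := Multiset.card_pos_iff_exists_mem.1 hpos
    have hall : ∀ b ∈ sliceRoots f ρ ε z', b = w := fun b hb => uniq z' hz' ρ hρ b hb w hw
    have heq : sliceRoots f ρ ε z' = Multiset.replicate ((sliceRoots f c r z₀).count ρ) w :=
      Multiset.eq_replicate.2 ⟨hcard z' hz', hall⟩
    have hαw : α ρ z' = w := by
      simp only [hα]
      rw [heq, Multiset.map_replicate, Multiset.sum_replicate, pow_one, nsmul_eq_mul, ← mul_assoc,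
        inv_mul_cancel₀ (Nat.cast_ne_zero.2 hk.ne'), one_mul]
    rw [hαw]; exact heq
  have hαmem : ∀ z' ∈ ball z₀ δ, ∀ ρ ∈ S, α ρ z' ∈ sliceRoots f ρ ε z' := by
    intro z' hz' ρ hρ
    rw [hrep z' hz' ρ hρ, Multiset.mem_replicate]
    exact ⟨(Multiset.count_pos.2 (Multiset.mem_toFinset.1 hρ)).ne', rfl⟩
  refine ⟨δ, hδ, hδU, α, fun ρ hρ => ?_, fun ρ hρ => ?_, fun z' hz' ρ hρ => ?_,
    fun z' hz' ρ hρ ρ' hρ' hne => ?_, fun z' hz' => ?_⟩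
  · -- holomorphy: a multiple of a power sum on the small disc
    obtain ⟨hWρ, -⟩ := hdisc ρ hρ
    exact (hWρ.differentiableOn_powerSum 1).const_mul _
  · -- value at `z₀`: the unique root in `ball ρ ε` is `ρ`
    have hmem := hαmem z₀ (mem_ball_self hδ) ρ hρ
    obtain ⟨hWρ, -⟩ := hdisc ρ hρ
    have hρmem : ρ ∈ sliceRoots f ρ ε z₀ := by
      have hρbig : ρ ∈ sliceRoots f c r z₀ := Multiset.mem_toFinset.1 hρ
      have : ρ ∈ (sliceRoots f c r z₀).filter (· ∈ ball ρ ε) :=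
        Multiset.mem_filter.2 ⟨hρbig, mem_ball_self hε⟩
      rwa [hW.filter_sliceRoots_eq hWρ hδU (hsubρ ρ hρ) (mem_ball_self hδ)] at this
    exact uniq z₀ (mem_ball_self hδ) ρ hρ _ hmem _ hρmem
  · exact hsubρ ρ hρ (mem_ball_of_mem_rootMultiset (hαmem z' hz' ρ hρ))
  · intro heq
    have h1 := mem_ball_of_mem_rootMultiset (hαmem z' hz' ρ hρ)
    have h2 := mem_ball_of_mem_rootMultiset (hαmem z' hz' ρ' hρ')
    rw [heq] at h1
    rw [mem_ball] at h1 h2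
    have := hε2 ρ hρ ρ' hρ' hne
    have := dist_triangle_left ρ ρ' (α ρ' z')
    linarith
  · -- the root multiset splits along the discs
    ext w
    rw [Multiset.count_sum']
    by_cases hw : w ∈ sliceRoots f c r z'
    · obtain ⟨ρ, hρ, hwρ⟩ := key z' hz' w hw
      obtain ⟨hWρ, -⟩ := hdisc ρ hρ
      rw [Finset.sum_eq_single ρ]
      · rw [Multiset.count_nsmul, Multiset.count_singleton]
        have : w ∈ sliceRoots f ρ ε z' := by
          have : w ∈ (sliceRoots f c r z').filter (· ∈ ball ρ ε) := Multiset.mem_filter.2 ⟨hw, hwρ⟩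
          rwa [hW.filter_sliceRoots_eq hWρ hδU (hsubρ ρ hρ) hz'] at this
        have hwα : w = α ρ z' := uniq z' hz' ρ hρ _ this _ (hαmem z' hz' ρ hρ)
        rw [if_pos hwα, mul_one]
        -- the count in the big disc equals the count in the small disc
        have h1 : (sliceRoots f c r z').count w = ((sliceRoots f c r z').filter (· ∈ ball ρ ε)).count w := by
          rw [Multiset.count_filter, if_pos hwρ]
        rw [h1, hW.filter_sliceRoots_eq hWρ hδU (hsubρ ρ hρ) hz', hrep z' hz' ρ hρ, ← hwα,
          Multiset.count_replicate_self]
      · intro ρ' hρ' hne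
        rw [Multiset.count_nsmul, Multiset.count_singleton, if_neg, mul_zero]
        intro heq
        have h2 := mem_ball_of_mem_rootMultiset (hαmem z' hz' ρ' hρ')
        rw [← heq] at h2
        rw [mem_ball] at h2 hwρ
        have := hε2 ρ hρ ρ' hρ' (Ne.symm hne)
        have := dist_triangle_left ρ ρ' w
        linarith
      · intro h; exact absurd hρ h
    · rw [Multiset.count_eq_zero.2 hw, eq_comm]
      refine Finset.sum_eq_zero fun ρ hρ => ?_
      rw [Multiset.count_nsmul, Multiset.count_singleton, if_neg, mul_zero]
      intro heq
      apply hw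
      obtain ⟨hWρ, -⟩ := hdisc ρ hρ
      have := hαmem z' hz' ρ hρ
      rw [← heq, ← hW.filter_sliceRoots_eq hWρ hδU (hsubρ ρ hρ) hz', Multiset.mem_filter] at this
      exact this.1

end WeierstrassData

end Discriminant

/-! ## The Hankel discriminant: the locus where the number of distinct roots drops -/

section Hankel

open Finset Matrix

variable {E : Type*} [NormedAddCommGroup E] [NormedSpace ℂ E]

/-- Products of finitely many holomorphic scalar functions are holomorphic (a copy of the lemma of
the same name in `Literature/Analysis/Complex/InjectiveHolomorphic.lean`, kept private to avoid the
import). [folklore] -/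
private theorem differentiableOn_finset_prod {ι : Type*} (s : Finset ι) {g : ι → E → ℂ} {U : Set E}
    (h : ∀ i ∈ s, DifferentiableOn ℂ (g i) U) :
    DifferentiableOn ℂ (fun x => ∏ i ∈ s, g i x) U := by
  classical
  induction s using Finset.induction_on with
  | empty => simp only [Finset.prod_empty]; exact differentiableOn_const _
  | insert a s ha ih =>
    simp_rw [Finset.prod_insert ha]
    exact (h a (Finset.mem_insert_self a s)).mul (ih fun i hi => h i (Finset.mem_insert_of_mem hi))

/-- Determinants of matrices of holomorphic functions are holomorphic. [folklore] -/
theorem differentiableOn_det {m : ℕ} {A : E → Matrix (Fin m) (Fin m) ℂ} {U : Set E}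
    (h : ∀ i j, DifferentiableOn ℂ (fun x => A x i j) U) :
    DifferentiableOn ℂ (fun x => (A x).det) U := by
  simp_rw [Matrix.det_apply']
  refine DifferentiableOn.fun_sum fun σ _ => ?_
  exact (Literature.Analysis.Complex.SCV.differentiableOn_finset_prod _ fun i _ => h (σ i) i).const_mul _

/-- The power sums of a multiset as sums over its distinct elements weighted by multiplicity.
[folklore] -/
theorem multiset_powerSum_eq_sum_count (M : Multiset ℂ) (p : ℕ) :
    (M.map (· ^ p)).sum = ∑ ρ ∈ M.toFinset, (M.count ρ : ℂ) * ρ ^ p := by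
  classical
  rw [Finset.sum_multiset_map_count]
  simp_rw [nsmul_eq_mul]

/-- **The Hankel matrix of power sums** `(s_{i+j})_{i,j<m}` of a multiset `M` of complex numbers
(`s_p = Σ_{ρ ∈ M} ρ^p`). Its determinant vanishes iff `M` has fewer than `m` distinct elements
(`hankel_det_eq_zero_of_card_lt`, `hankel_det_ne_zero_of_card_eq`). [folklore] -/
noncomputable def hankel (M : Multiset ℂ) (m : ℕ) : Matrix (Fin m) (Fin m) ℂ :=
  Matrix.of fun i j => (M.map (· ^ ((i : ℕ) + j))).sum

/-- **Rank bound**: if `M` has fewer than `m` distinct elements, the `m × m` Hankel determinant of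
its power sums vanishes (the Hankel matrix is `Σ_ρ k_ρ v_ρ v_ρᵀ`, of rank at most the number of
distinct `ρ`). [folklore] -/
theorem hankel_det_eq_zero_of_card_lt (M : Multiset ℂ) {m : ℕ} (hm : M.toFinset.card < m) :
    (hankel M m).det = 0 := by
  classical
  set D := M.toFinset with hD
  -- the (rectangular) Vandermonde matrix of the distinct elements
  set V : Matrix D (Fin m) ℂ := Matrix.of fun ρ j => (ρ : ℂ) ^ (j : ℕ) with hV
  have hker : LinearMap.ker (Matrix.mulVecLin V) ≠ ⊥ := by
    apply LinearMap.ker_ne_bot_of_finrank_lt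
    simpa using hm
  obtain ⟨x, hxker, hx0⟩ := Submodule.exists_mem_ne_zero_of_ne_bot hker
  rw [LinearMap.mem_ker, Matrix.mulVecLin_apply] at hxker
  have hVx : ∀ ρ : D, ∑ j : Fin m, (ρ : ℂ) ^ (j : ℕ) * x j = 0 := fun ρ => by
    have := congrFun hxker ρ
    simpa [Matrix.mulVec, dotProduct, hV] using this
  refine Matrix.exists_mulVec_eq_zero_iff.1 ⟨x, hx0, ?_⟩
  ext i
  simp only [Matrix.mulVec, dotProduct, hankel, Matrix.of_apply, Pi.zero_apply]
  simp_rw [multiset_powerSum_eq_sum_count, Finset.sum_mul, pow_add]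
  rw [Finset.sum_comm]
  refine Finset.sum_eq_zero fun ρ hρ => ?_
  have h := hVx ⟨ρ, hρ⟩
  simp only at h
  calc ∑ j : Fin m, (M.count ρ : ℂ) * (ρ ^ (i : ℕ) * ρ ^ (j : ℕ)) * x j
      = (M.count ρ : ℂ) * ρ ^ (i : ℕ) * ∑ j : Fin m, ρ ^ (j : ℕ) * x j := by
        rw [Finset.mul_sum]; refine Finset.sum_congr rfl fun j _ => by ring
    _ = 0 := by rw [h, mul_zero]

/-- **Vandermonde**: if `M` has exactly `m` distinct elements, the `m × m` Hankel determinant of its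
power sums is `det(V)² ∏ k_ρ ≠ 0` (`V` the Vandermonde matrix of the distinct elements, `k_ρ ≥ 1`
their multiplicities). [folklore] -/
theorem hankel_det_ne_zero_of_card_eq (M : Multiset ℂ) {m : ℕ} (hm : M.toFinset.card = m) :
    (hankel M m).det ≠ 0 := by
  classical
  set D := M.toFinset with hD
  -- enumerate the distinct elements
  set e : Fin m ≃ D := (D.equivFinOfCardEq hm).symm with he
  set ρ : Fin m → ℂ := fun a => (e a : ℂ) with hρ
  have hρinj : Function.Injective ρ := fun a b hab => e.injective (Subtype.ext hab)
  set d : Fin m → ℂ := fun a => (M.count (e a : ℂ) : ℂ) with hd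
  have hd0 : ∀ a, d a ≠ 0 := fun a => by
    have : (e a : ℂ) ∈ M := Multiset.mem_toFinset.1 (e a).2
    exact Nat.cast_ne_zero.2 (Multiset.count_pos.2 this).ne'
  have hH : hankel M m = (vandermonde ρ)ᵀ * (Matrix.diagonal d * vandermonde ρ) := by
    ext i j
    simp only [hankel, Matrix.of_apply, Matrix.mul_apply, Matrix.transpose_apply,
      vandermonde_apply, Matrix.diagonal_apply, ite_mul, zero_mul, Finset.sum_ite_eq,
      Finset.mem_univ, if_true]
    rw [multiset_powerSum_eq_sum_count]
    -- reindex the sum over `D` by `Fin m`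
    rw [← Finset.sum_coe_sort D, ← e.sum_comp]
    refine Finset.sum_congr rfl fun a _ => ?_
    simp only [pow_add]
    ring
  rw [hH, det_mul, det_mul, det_transpose, det_diagonal]
  have hV : (vandermonde ρ).det ≠ 0 := det_vandermonde_ne_zero_iff.2 hρinj
  exact mul_ne_zero hV (mul_ne_zero (Finset.prod_ne_zero_iff.2 fun a _ => hd0 a) hV)

end Hankel

section Discriminant2

variable {E : Type*} [NormedAddCommGroup E] [NormedSpace ℂ E]
variable {f : E × ℂ → ℂ} {U' : Set E} {c : ℂ} {r R : ℝ}

/-- The **Hankel discriminant** of order `m` of the slices of `f`: the determinant of the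
`m × m` Hankel matrix of the power sums of the zeros of `f (z', ·)` in the disc.
[Chirka, *Complex Analytic Sets*, §1.3 (discriminant set)] [folklore] -/
noncomputable def hankelDisc (f : E × ℂ → ℂ) (c : ℂ) (r : ℝ) (m : ℕ) (z' : E) : ℂ :=
  (hankel (sliceRoots f c r z') m).det

namespace WeierstrassData

/-- The Hankel discriminant is holomorphic in the parameter (its entries are power sums of the
roots, `differentiableOn_powerSum`). [cite: Chirka1989, §1.3, p. 7] -/
theorem differentiableOn_hankelDisc (hW : WeierstrassData f U' c r R) (m : ℕ) :
    DifferentiableOn ℂ (hankelDisc f c r m) U' :=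
  differentiableOn_det fun i j => by
    simpa only [hankel, Matrix.of_apply] using hW.differentiableOn_powerSum ((i : ℕ) + j)

omit [NormedAddCommGroup E] [NormedSpace ℂ E] in
/-- The number of distinct roots is at most the number of roots. [folklore] -/
theorem distinctRoots_le_card (z' : E) :
    distinctRoots f c r z' ≤ (sliceRoots f c r z').card :=
  Multiset.toFinset_card_le _

/-- **The discriminant set** (Chirka §1.3): on a preconnected parameter set there is a holomorphic
function `μ` (the Hankel discriminant of order the maximal number `m₀` of distinct roots), not
identically zero, such that at every point where `μ ≠ 0` the number of distinct zeros of the slice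
is maximal (`= m₀`); there the distinct roots are locally holomorphic functions
(`exists_holomorphic_roots`). [cite: Chirka1989, §1.3, p. 7–8] -/
theorem exists_discriminant (hW : WeierstrassData f U' c r R) (hU' : IsPreconnected U')
    (hne : U'.Nonempty) :
    ∃ μ : E → ℂ, DifferentiableOn ℂ μ U' ∧ (∃ z' ∈ U', μ z' ≠ 0) ∧
      ∀ z₀ ∈ U', μ z₀ ≠ 0 → ∀ z' ∈ U', distinctRoots f c r z' ≤ distinctRoots f c r z₀ := by
  classical
  obtain ⟨z₁, hz₁⟩ := hne
  -- the maximal number of distinct roots, attained at some `z₀`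
  set k := (sliceRoots f c r z₁).card with hk
  have hbound : ∀ z' ∈ U', distinctRoots f c r z' ≤ k := fun z' hz' =>
    (distinctRoots_le_card z').trans (hW.card_sliceRoots_eq hU' hz₁ hz').le
  set s : Set ℕ := distinctRoots f c r '' U' with hs
  have hsfin : s.Finite := (Set.finite_Iic k).subset (by
    rintro _ ⟨z', hz', rfl⟩; exact hbound z' hz')
  have hsne : s.Nonempty := ⟨_, z₁, hz₁, rfl⟩
  obtain ⟨m₀, ⟨z₀, hz₀, rfl⟩, hmax⟩ := hsfin.exists_maximal hsne
  have hmax' : ∀ z' ∈ U', distinctRoots f c r z' ≤ distinctRoots f c r z₀ := fun z' hz' => by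
    by_contra hlt
    rw [not_le] at hlt
    exact (lt_irrefl _) (hlt.trans_le (hmax ⟨z', hz', rfl⟩ hlt.le))
  refine ⟨hankelDisc f c r (distinctRoots f c r z₀), hW.differentiableOn_hankelDisc _,
    ⟨z₀, hz₀, hankel_det_ne_zero_of_card_eq _ rfl⟩, fun z hz hμ z' hz' => ?_⟩
  -- where `μ ≠ 0` the number of distinct roots is not `< m₀`, hence `= m₀`
  have hnotlt : ¬ distinctRoots f c r z < distinctRoots f c r z₀ := fun hlt =>
    hμ (hankel_det_eq_zero_of_card_lt _ hlt)
  exact (hmax' z' hz').trans (not_lt.1 hnotlt)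

/-- **Holomorphic simple-root functions off the discriminant set.** Combination of
`exists_discriminant` and `exists_holomorphic_roots`: on a preconnected nonempty parameter set
there is a holomorphic `μ ≢ 0` such that near every point `z₀` with `μ z₀ ≠ 0` the zeros of the
slices `f (z', ·)` in the disc are the values of finitely many holomorphic functions with pairwise
distinct values. [cite: Chirka1989, §1.3, p. 7–8] -/
theorem exists_discriminant_roots (hW : WeierstrassData f U' c r R) (hU' : IsPreconnected U')
    (hne : U'.Nonempty) :
    ∃ μ : E → ℂ, DifferentiableOn ℂ μ U' ∧ (∃ z' ∈ U', μ z' ≠ 0) ∧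
      ∀ z₀ ∈ U', μ z₀ ≠ 0 → ∃ δ > 0, ball z₀ δ ⊆ U' ∧ ∃ (s : ℕ) (β : Fin s → E → ℂ),
        (∀ i, DifferentiableOn ℂ (β i) (ball z₀ δ)) ∧
        (∀ z' ∈ ball z₀ δ, ∀ i j, i ≠ j → β i z' ≠ β j z') ∧
        (∀ z' ∈ ball z₀ δ, ∀ i, β i z' ∈ ball c r) ∧
        ∀ z' ∈ ball z₀ δ, ∀ w, w ∈ sliceRoots f c r z' ↔ ∃ i, w = β i z' := by
  classical
  obtain ⟨μ, hμd, hμne, hμmax⟩ := hW.exists_discriminant hU' hne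
  refine ⟨μ, hμd, hμne, fun z₀ hz₀ hμ0 => ?_⟩
  obtain ⟨δ, hδ, hδU, α, hαd, -, hαmem, hαne, hroots⟩ :=
    hW.exists_holomorphic_roots hz₀ (hμmax z₀ hz₀ hμ0)
  set S := (sliceRoots f c r z₀).toFinset with hS
  set e : Fin S.card ≃ S := S.equivFin.symm with he
  refine ⟨δ, hδ, hδU, S.card, fun i => α (e i), fun i => hαd _ (e i).2,
    fun z' hz' i j hij => hαne z' hz' _ (e i).2 _ (e j).2 fun h => hij (e.injective (Subtype.ext h)),
    fun z' hz' i => hαmem z' hz' _ (e i).2, fun z' hz' w => ?_⟩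
  rw [hroots z' hz', Multiset.mem_sum]
  constructor
  · rintro ⟨ρ, hρ, hw⟩
    rw [Multiset.mem_nsmul] at hw
    refine ⟨e.symm ⟨ρ, hρ⟩, ?_⟩
    rw [Multiset.mem_singleton] at hw
    simpa [he] using hw.2
  · rintro ⟨i, rfl⟩
    refine ⟨e i, (e i).2, ?_⟩
    rw [Multiset.mem_nsmul, Multiset.mem_singleton]
    exact ⟨(Multiset.count_pos.2 (Multiset.mem_toFinset.1 (e i).2)).ne', rfl⟩

end WeierstrassData

end Discriminant2

/-! ## Elimination: images of analytic sets under finite projections (Chirka §3.2) -/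

section Elimination

variable {E : Type*} [NormedAddCommGroup E] [NormedSpace ℂ E]

/-- `IsZeroSetAt Z x`: the subset `Z` of the complex normed space `E` is *cut out near `x` by
finitely many holomorphic equations*: there are an open `U ∋ x` and `g : E → ℂᴺ` holomorphic on
`U` with `Z ∩ U = U ∩ g⁻¹(0)` (`N = 0` allowed: `Z ⊇ U`). This is *provably equivalent*
(`isZeroSetAt_iff_isAnalyticSetAt`, via `mdifferentiableOn_iff_differentiableOn`; not a
definitional equality) to the model-space instance `Literature.IsAnalyticSetAt 𝓘(ℂ, E) Z x` of the
manifold-level predicate of `Literature/Geometry/Kaehler/AnalyticSet.lean`; it is kept as a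
separate name so that the elimination and cover theory below stays in plain normed-space
language. [Chirka, *Complex Analytic Sets*, §2.1]
[folklore] -/
def IsZeroSetAt (Z : Set E) (x : E) : Prop :=
  ∃ U : Set E, IsOpen U ∧ x ∈ U ∧ ∃ (N : ℕ) (g : E → (Fin N → ℂ)),
    DifferentiableOn ℂ g U ∧ Z ∩ U = U ∩ g ⁻¹' {0}

open scoped Manifold in
/-- **Bridge to the manifold-level predicate**: `IsZeroSetAt Z x ↔ Literature.IsAnalyticSetAt 𝓘(ℂ, E) Z x`
(the model space as a manifold modelled on itself; `MDifferentiableOn ↔ DifferentiableOn`).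
[folklore] -/
theorem isZeroSetAt_iff_isAnalyticSetAt {Z : Set E} {x : E} :
    IsZeroSetAt Z x ↔ Literature.Geometry.Kaehler.IsAnalyticSetAt 𝓘(ℂ, E) Z x := by
  simp only [Literature.Geometry.Kaehler.IsAnalyticSetAt, IsZeroSetAt, mdifferentiableOn_iff_differentiableOn]

omit [NormedSpace ℂ E] in
/-- Two sets which agree near `x` are simultaneously cut out by holomorphic equations near `x`.
[folklore] -/
theorem IsZeroSetAt.congr [NormedSpace ℂ E] {Z Z' : Set E} {x : E} (h : IsZeroSetAt Z x)
    {V : Set E} (hV : IsOpen V) (hx : x ∈ V) (hZZ' : Z ∩ V = Z' ∩ V) : IsZeroSetAt Z' x := by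
  obtain ⟨U, hU, hxU, N, g, hg, hZU⟩ := h
  refine ⟨U ∩ V, hU.inter hV, ⟨hxU, hx⟩, N, g, hg.mono inter_subset_left, ?_⟩
  rw [show Z' ∩ (U ∩ V) = (Z' ∩ V) ∩ U by ac_rfl, ← hZZ', show (Z ∩ V) ∩ U = (Z ∩ U) ∩ V by ac_rfl,
    hZU]
  ext y; constructor
  · rintro ⟨⟨hyU, hy⟩, hyV⟩; exact ⟨⟨hyU, hyV⟩, hy⟩
  · rintro ⟨⟨hyU, hyV⟩, hy⟩; exact ⟨⟨hyU, hy⟩, hyV⟩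

/-- **Vandermonde.** If `Σ_l t_i^l v_l = 0` for `N` distinct complex numbers `t_i`, then `v = 0`.
[folklore] -/
theorem eq_zero_of_sum_pow_mul_eq_zero {N : ℕ} {v t : Fin N → ℂ} (ht : Function.Injective t)
    (h : ∀ i, ∑ l : Fin N, t i ^ (l : ℕ) * v l = 0) : v = 0 :=
  Matrix.eq_zero_of_mulVec_eq_zero (Matrix.det_vandermonde_ne_zero_iff.2 ht)
    (funext fun i => by simpa [Matrix.mulVec, dotProduct, Matrix.vandermonde_apply] using h i)

/-- If a holomorphic vector function of one variable has an isolated zero (or no zero) at `c`,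
some component is not identically zero near `c`. [folklore] -/
theorem exists_apply_not_eventuallyEq_zero {N : ℕ} {F : ℂ → (Fin N → ℂ)} {c : ℂ}
    (h : ∀ᶠ w in 𝓝[≠] c, F w ≠ 0) : ∃ l, ¬ (fun w => F w l) =ᶠ[𝓝 c] 0 := by
  by_contra hall
  simp only [not_exists, not_not] at hall
  have h0 : ∀ᶠ w in 𝓝 c, F w = 0 :=
    (Filter.eventually_all.2 hall).mono fun w hw => funext fun l => hw l
  have hfalse : ∀ᶠ w in 𝓝[≠] c, False :=
    (h.and (h0.filter_mono nhdsWithin_le_nhds)).mono fun w hw => hw.1 hw.2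
  obtain ⟨w, hw⟩ := hfalse.exists
  exact hw

variable {E' : Type*} [NormedAddCommGroup E'] [NormedSpace ℂ E']

/-- **Elimination of one variable** (Chirka §3.2, the basic step `m = 1`, in the "norm" form).
Let `f = (f_l) : E' × ℂ → ℂᴺ` be holomorphic on an open `W ∋ (a', c)` and suppose `c` is an
isolated point of (or not in) the zero set of `f (a', ·)`. Then some `f_{l₀} (a', ·)` has an isolated
zero at `c`, the Weierstrass set-up `WeierstrassData f_{l₀} (ball a' ε) c r R` holds, and the
projection `{z' ∈ ball a' ε : ∃ w, |w - c| < r, f (z', w) = 0}` of the zero set is the common zero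
set of finitely many functions holomorphic on `ball a' ε`, namely the norms
`N_t (z') = ∏_{ρ} Σ_l t^l f_l (z', ρ)` over the roots `ρ` of `f_{l₀} (z', ·)` for
`k (N - 1) + 1` values of `t` (`k` the number of roots): if all `N_t (z')` vanish, by the
pigeonhole principle one root `ρ` kills `Σ_l t^l f_l (z', ρ)` for `N` values of `t`, whence
`f (z', ρ) = 0` (Vandermonde). [cite: Chirka1989, §3.2 Thm. (case m = 1)] -/
theorem exists_equations_image_fst {N : ℕ} {f : E' × ℂ → (Fin N → ℂ)} {W : Set (E' × ℂ)}
    (hW : IsOpen W) (hf : DifferentiableOn ℂ f W) {a' : E'} {c : ℂ} (ha : (a', c) ∈ W)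
    (hiso : ∀ᶠ w in 𝓝[≠] c, f (a', w) ≠ 0) :
    ∃ ε r R : ℝ, 0 < ε ∧ 0 < r ∧ r < R ∧ ball a' ε ×ˢ ball c R ⊆ W ∧
      (∀ z' ∈ ball a' ε, ∀ w ∈ sphere c r, f (z', w) ≠ 0) ∧
      ∃ (M : ℕ) (g : E' → (Fin M → ℂ)), DifferentiableOn ℂ g (ball a' ε) ∧
        ∀ z' ∈ ball a' ε, g z' = 0 ↔ ∃ w ∈ ball c r, f (z', w) = 0 := by
  classical
  obtain ⟨l₀, hl₀⟩ := exists_apply_not_eventuallyEq_zero hiso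
  set F : E' × ℂ → ℂ := fun x => f x l₀ with hFdef
  have hF : DifferentiableOn ℂ F W := differentiableOn_pi.1 hf l₀
  obtain ⟨ε, r, R, hε, hsub, hWD, -, -⟩ := exists_weierstrassData hW hF ha hl₀
  -- the auxiliary functions `g_t = Σ_l t^l f_l` and their norms over the roots
  set gt : ℂ → E' × ℂ → ℂ := fun t x => ∑ l : Fin N, t ^ (l : ℕ) * f x l with hgt_def
  have hgt : ∀ t, DifferentiableOn ℂ (gt t) (ball a' ε ×ˢ ball c R) := fun t =>
    DifferentiableOn.fun_sum fun l _ => ((differentiableOn_pi.1 (hf.mono hsub) l).const_mul _)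
  set k := (sliceRoots F c r a').card with hk_def
  set M := k * (N - 1) + 1 with hM_def
  set g : E' → Fin M → ℂ := fun z' i =>
    ((sliceRoots F c r z').map fun ρ => gt (i : ℂ) (z', ρ)).prod with hg_def
  refine ⟨ε, r, R, hε, hWD.pos, hWD.lt, hsub, fun z' hz' w hw h0 =>
    hWD.ne_zero z' hz' w hw (by simp [hFdef, h0]), M, g,
    differentiableOn_pi.2 fun i => hWD.differentiableOn_rootProd (hgt _), fun z' hz' => ?_⟩
  have hk : (sliceRoots F c r z').card = k :=
    hWD.card_sliceRoots_eq (convex_ball _ _).isPreconnected (mem_ball_self hε) hz'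
  have hmem : ∀ w, w ∈ sliceRoots F c r z' ↔ w ∈ ball c r ∧ F (z', w) = 0 := fun w =>
    mem_rootMultiset_iff (hWD.differentiableOn_slice hz') hWD.pos hWD.lt (hWD.ne_zero z' hz')
  constructor
  · intro hg0
    -- each norm vanishes: pick a root `φ i` killing `g_i`
    have hex : ∀ i : Fin M, ∃ ρ ∈ (sliceRoots F c r z').toFinset, gt (i : ℂ) (z', ρ) = 0 := by
      intro i
      have h := congrFun hg0 i
      simp only [hg_def, Pi.zero_apply, Multiset.prod_eq_zero_iff, Multiset.mem_map] at h
      obtain ⟨ρ, hρ, h0⟩ := h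
      exact ⟨ρ, Multiset.mem_toFinset.2 hρ, h0⟩
    choose φ hφmem hφzero using hex
    -- pigeonhole: some root is chosen for at least `N` values of `i`
    obtain ⟨ρ, hρD, hcard⟩ := Finset.exists_lt_card_fiber_of_mul_lt_card_of_maps_to
      (s := Finset.univ) (t := (sliceRoots F c r z').toFinset) (f := φ) (n := N - 1)
      (fun i _ => hφmem i) (by
        rw [Finset.card_univ, Fintype.card_fin, hM_def]
        calc (sliceRoots F c r z').toFinset.card * (N - 1) ≤ k * (N - 1) :=
              Nat.mul_le_mul_right _ ((Multiset.toFinset_card_le _).trans hk.le)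
          _ < k * (N - 1) + 1 := Nat.lt_succ_self _)
    set fib := Finset.univ.filter fun i : Fin M => φ i = ρ with hfib
    have hN : N ≤ fib.card := by omega
    obtain ⟨s, hs, hscard⟩ := Finset.exists_subset_card_eq hN
    set e := s.equivFinOfCardEq hscard with he
    set t : Fin N → ℂ := fun j => (((e.symm j : Fin M) : ℕ) : ℂ) with ht_def
    have ht : Function.Injective t := by
      intro j j' h
      simp only [ht_def, Nat.cast_inj] at h
      exact e.symm.injective (Subtype.ext (Fin.ext h))
    have hv : (fun l => f (z', ρ) l) = 0 := eq_zero_of_sum_pow_mul_eq_zero ht fun j => by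
      have hj : (e.symm j : Fin M) ∈ fib := hs (e.symm j).2
      have h0 := hφzero (e.symm j)
      rw [(Finset.mem_filter.1 hj).2] at h0
      simpa [hgt_def, ht_def] using h0
    exact ⟨ρ, ((hmem ρ).1 (Multiset.mem_toFinset.1 hρD)).1, funext fun l => congrFun hv l⟩
  · rintro ⟨w, hw, hfw⟩
    have hwr : w ∈ sliceRoots F c r z' := (hmem w).2 ⟨hw, by simp [hFdef, hfw]⟩
    funext i
    simp only [hg_def, Pi.zero_apply]
    exact Multiset.prod_eq_zero (Multiset.mem_map.2 ⟨w, hwr, by simp [hgt_def, hfw]⟩)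

/-! ### Splitting off one fibre coordinate -/

/-- Split `E' × ℂ^{m+1} → (E' × ℂ^m) × ℂ`, `(z', w) ↦ ((z', tail w), w 0)`. [folklore] -/
def finSplit (E' : Type*) (m : ℕ) (p : E' × (Fin (m + 1) → ℂ)) : (E' × (Fin m → ℂ)) × ℂ :=
  ((p.1, Fin.tail p.2), p.2 0)

/-- Inverse of `finSplit`: `((z', u), t) ↦ (z', cons t u)`. [folklore] -/
def finUnsplit (E' : Type*) (m : ℕ) (q : (E' × (Fin m → ℂ)) × ℂ) : E' × (Fin (m + 1) → ℂ) :=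
  (q.1.1, Fin.cons q.2 q.1.2)

omit [NormedAddCommGroup E'] [NormedSpace ℂ E'] in
/-- `finUnsplit ∘ finSplit = id`. [folklore] -/
@[simp] theorem finUnsplit_finSplit (m : ℕ) (p : E' × (Fin (m + 1) → ℂ)) :
    finUnsplit E' m (finSplit E' m p) = p := by
  simp [finSplit, finUnsplit, Fin.cons_self_tail]

omit [NormedAddCommGroup E'] [NormedSpace ℂ E'] in
/-- `finSplit ∘ finUnsplit = id`. [folklore] -/
@[simp] theorem finSplit_finUnsplit (m : ℕ) (q : (E' × (Fin m → ℂ)) × ℂ) :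
    finSplit E' m (finUnsplit E' m q) = q := by
  simp [finSplit, finUnsplit, Fin.tail_cons, Fin.cons_zero]

/-- `finSplit` is complex-differentiable (it is linear). [folklore] -/
theorem differentiable_finSplit (m : ℕ) : Differentiable ℂ (finSplit E' m) := by
  unfold finSplit Fin.tail; fun_prop

/-- `finUnsplit` is complex-differentiable (it is linear). [folklore] -/
theorem differentiable_finUnsplit (m : ℕ) : Differentiable ℂ (finUnsplit E' m) := by
  have h : ∀ q : (E' × (Fin m → ℂ)) × ℂ,
      Fin.cons q.2 q.1.2 = Fin.consEquivL ℂ (fun _ : Fin (m + 1) => ℂ) (q.2, q.1.2) := fun q => rfl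
  unfold finUnsplit
  simp_rw [h]
  fun_prop

omit [NormedSpace ℂ E'] in
/-- `finSplit` is continuous. [folklore] -/
theorem continuous_finSplit (m : ℕ) : Continuous (finSplit E' m) := by
  unfold finSplit Fin.tail; fun_prop

/-- `finUnsplit` is continuous. [folklore] -/
theorem continuous_finUnsplit (m : ℕ) : Continuous (finUnsplit E' m) :=
  (differentiable_finUnsplit m).continuous

/-- **Images of analytic sets under finite projections are analytic** (Chirka §3.2 Thm., local
form at a point). Let `f : E' × ℂᵐ → ℂᴺ` be holomorphic on an open `W ∋ a = (a', a'')` and let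
`a''` be an isolated point of (or not in) the zero set of `f (a', ·)`. Then there is an open
neighbourhood `V ⊆ W` of `a` such that the projection to `E'` of the zero set of `f` in `V` is cut
out near `a'` by finitely many holomorphic equations. Proof by induction on `m`, eliminating one
coordinate at a time (`exists_equations_image_fst`).
[cite: Chirka1989, §3.2 Thm.] -/
theorem isZeroSetAt_image_fst (m : ℕ) : ∀ {N : ℕ} {f : E' × (Fin m → ℂ) → (Fin N → ℂ)}
    {W : Set (E' × (Fin m → ℂ))}, IsOpen W → DifferentiableOn ℂ f W →
    ∀ {a : E' × (Fin m → ℂ)}, a ∈ W → (∀ᶠ w in 𝓝[≠] a.2, f (a.1, w) ≠ 0) →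
    ∃ V : Set (E' × (Fin m → ℂ)), IsOpen V ∧ a ∈ V ∧ V ⊆ W ∧
      IsZeroSetAt (Prod.fst '' (V ∩ f ⁻¹' {0})) a.1 := by
  induction m with
  | zero =>
    intro N f W hW hf a ha _
    refine ⟨W, hW, ha, Subset.rfl, ?_⟩
    set U : Set E' := (fun z' => (z', a.2)) ⁻¹' W with hU
    have hUo : IsOpen U := hW.preimage (by fun_prop)
    refine ⟨U, hUo, ha, N, fun z' => f (z', a.2), hf.comp (by fun_prop) fun z' hz' => hz', ?_⟩
    ext z'
    simp only [mem_inter_iff, mem_image, mem_preimage, mem_singleton_iff, Prod.exists,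
      exists_and_right, exists_eq_right, hU]
    constructor
    · rintro ⟨⟨w, hwW, hw0⟩, hz'⟩
      obtain rfl : w = a.2 := Subsingleton.elim _ _
      exact ⟨hz', hw0⟩
    · rintro ⟨hz', h0⟩
      exact ⟨⟨a.2, hz', h0⟩, hz'⟩
  | succ m ih =>
    intro N f W hW hf a ha hiso
    -- a neighbourhood of `a.2` on which `f (a.1, ·)` vanishes only at `a.2`
    obtain ⟨δ, hδ, hδiso⟩ : ∃ δ > 0, ∀ t : ℂ, ∀ u : Fin m → ℂ, dist t (a.2 0) < δ →
        dist u (Fin.tail a.2) < δ → Fin.cons t u ≠ a.2 → f (a.1, Fin.cons t u) ≠ 0 := by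
      have h1 : {w | w ≠ a.2 → f (a.1, w) ≠ 0} ∈ 𝓝 a.2 := by
        have := hiso
        rw [eventually_nhdsWithin_iff] at this
        exact this
      have hc : Continuous fun q : ℂ × (Fin m → ℂ) => (Fin.cons q.1 q.2 : Fin (m + 1) → ℂ) := by
        have : (fun q : ℂ × (Fin m → ℂ) => (Fin.cons q.1 q.2 : Fin (m + 1) → ℂ)) =
            fun q => finUnsplit E' m ((a.1, q.2), q.1) |>.2 := by
          funext q; rfl
        rw [this]
        exact continuous_snd.comp ((continuous_finUnsplit m).comp (by fun_prop))
      have h2 : (fun q : ℂ × (Fin m → ℂ) => (Fin.cons q.1 q.2 : Fin (m + 1) → ℂ)) ⁻¹'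
          {w | w ≠ a.2 → f (a.1, w) ≠ 0} ∈ 𝓝 (a.2 0, Fin.tail a.2) := by
        refine hc.continuousAt.preimage_mem_nhds ?_
        rw [Fin.cons_self_tail]; exact h1
      obtain ⟨δ, hδ, hball⟩ := Metric.mem_nhds_iff.1 h2
      refine ⟨δ, hδ, fun t u ht hu hne => ?_⟩
      have : (t, u) ∈ ball (a.2 0, Fin.tail a.2) δ := by
        rw [mem_ball, Prod.dist_eq]; exact max_lt ht hu
      exact hball this hne
    -- transport to `(E' × ℂᵐ) × ℂ` and shrink the last disc below `δ`
    set c : ℂ := a.2 0 with hc_def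
    set W₁ : Set ((E' × (Fin m → ℂ)) × ℂ) :=
      (finUnsplit E' m) ⁻¹' W ∩ (univ ×ˢ ball c δ) with hW₁
    have hW₁o : IsOpen W₁ :=
      (hW.preimage (continuous_finUnsplit m)).inter (isOpen_univ.prod isOpen_ball)
    set f₁ : (E' × (Fin m → ℂ)) × ℂ → (Fin N → ℂ) := f ∘ finUnsplit E' m with hf₁
    have hf₁d : DifferentiableOn ℂ f₁ W₁ :=
      hf.comp (differentiable_finUnsplit m).differentiableOn fun q hq => hq.1
    set a₁ : E' × (Fin m → ℂ) := (a.1, Fin.tail a.2) with ha₁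
    have ha₁W : (a₁, c) ∈ W₁ := by
      refine ⟨?_, mem_univ _, mem_ball_self hδ⟩
      show finUnsplit E' m ((a.1, Fin.tail a.2), a.2 0) ∈ W
      have : finUnsplit E' m ((a.1, Fin.tail a.2), a.2 0) = a := finUnsplit_finSplit m a
      rw [this]; exact ha
    have hiso₁ : ∀ᶠ t in 𝓝[≠] c, f₁ (a₁, t) ≠ 0 := by
      rw [eventually_nhdsWithin_iff, Metric.eventually_nhds_iff]
      refine ⟨δ, hδ, fun t ht htc => ?_⟩
      refine hδiso t (Fin.tail a.2) ht (by simpa using hδ) fun h => htc ?_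
      have := congrFun h 0
      simpa using this
    obtain ⟨ε, r, R, hε, hr, hrR, hsub, -, M, g, hgd, hgiff⟩ :=
      exists_equations_image_fst hW₁o hf₁d ha₁W hiso₁
    have hRδ : R ≤ δ := by
      by_contra hlt
      rw [not_le] at hlt
      -- a point of `ball c R` outside `ball c δ`
      have hmem : (a₁, c + δ) ∈ ball a₁ ε ×ˢ ball c R :=
        mk_mem_prod (mem_ball_self hε) (by simpa [mem_ball, abs_of_pos hδ] using hlt)
      have := (hsub hmem).2.2
      simp [mem_ball, abs_of_pos hδ] at this
    -- isolation for the eliminated system `g` at `a₁`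
    have hiso₂ : ∀ᶠ u in 𝓝[≠] a₁.2, g (a₁.1, u) ≠ 0 := by
      have hball : ∀ᶠ u in 𝓝 a₁.2, (a₁.1, u) ∈ ball a₁ ε ∧ dist u a₁.2 < δ := by
        refine Filter.Eventually.and ?_ (Metric.eventually_nhds_iff.2 ⟨δ, hδ, fun u hu => hu⟩)
        have : Continuous fun u : Fin m → ℂ => ((a₁.1, u) : E' × (Fin m → ℂ)) := by fun_prop
        exact this.continuousAt.preimage_mem_nhds (isOpen_ball.mem_nhds (by
          show (a₁.1, a₁.2) ∈ ball a₁ ε; exact mem_ball_self hε))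
      rw [eventually_nhdsWithin_iff]
      refine hball.mono fun u hu hne hg0 => ?_
      obtain ⟨t, ht, hft⟩ := (hgiff _ hu.1).1 hg0
      refine hδiso t u (lt_of_lt_of_le (mem_ball.1 ht) (hrR.le.trans hRδ)) hu.2 (fun h => hne ?_) hft
      have := congrArg Fin.tail h
      simpa [ha₁] using this
    obtain ⟨V₂, hV₂o, haV₂, hV₂sub, hZ₂⟩ := ih isOpen_ball hgd (a := a₁) (mem_ball_self hε) hiso₂
    -- the neighbourhood `V` of `a`
    set V : Set (E' × (Fin (m + 1) → ℂ)) := (finSplit E' m) ⁻¹' (V₂ ×ˢ ball c r) with hV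
    refine ⟨V, (hV₂o.prod isOpen_ball).preimage (continuous_finSplit m), ?_, ?_, ?_⟩
    · show finSplit E' m a ∈ V₂ ×ˢ ball c r
      exact mk_mem_prod haV₂ (mem_ball_self hr)
    · intro p hp
      have hp' : finSplit E' m p ∈ ball a₁ ε ×ˢ ball c R :=
        ⟨hV₂sub hp.1, ball_subset_ball hrR.le hp.2⟩
      have := (hsub hp').1
      simpa using this
    · -- the two projections agree
      convert hZ₂ using 1
      ext z'
      simp only [mem_image, mem_inter_iff, mem_preimage, mem_singleton_iff, Prod.exists,
        exists_and_right, exists_eq_right]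
      constructor
      · rintro ⟨w, hwV, hw0⟩
        have hwV' : finSplit E' m (z', w) ∈ V₂ ×ˢ ball c r := hwV
        refine ⟨Fin.tail w, hwV'.1, ?_⟩
        refine (hgiff _ (hV₂sub hwV'.1)).2 ⟨w 0, hwV'.2, ?_⟩
        show f (finUnsplit E' m (finSplit E' m (z', w))) = 0
        exact (congrArg f (finUnsplit_finSplit m (z', w))).trans hw0
      · rintro ⟨u, huV, hu0⟩
        obtain ⟨t, ht, hft⟩ := (hgiff _ (hV₂sub huV)).1 hu0
        refine ⟨Fin.cons t u, ?_, hft⟩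
        show finSplit E' m (z', Fin.cons t u) ∈ V₂ ×ˢ ball c r
        have : finSplit E' m (z', Fin.cons t u) = ((z', u), t) := finSplit_finUnsplit m ((z', u), t)
        rw [this]; exact mk_mem_prod huV ht

/-! ### Keeping one fibre coordinate: the shadow of an analytic set on a coordinate plane -/

/-- `(z', w) ↦ ((z', w i), tail (w ∘ swap 0 i))`: keep the coordinate `w i` in the base and move the
other coordinates to the fibre. [folklore] -/
def finShuffle (E' : Type*) (m : ℕ) (i : Fin (m + 1)) (p : E' × (Fin (m + 1) → ℂ)) :
    (E' × ℂ) × (Fin m → ℂ) :=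
  ((p.1, p.2 i), Fin.tail (p.2 ∘ Equiv.swap 0 i))

/-- Inverse of `finShuffle`: `((z', t), u) ↦ (z', (cons t u) ∘ swap 0 i)`. [folklore] -/
def finUnshuffle (E' : Type*) (m : ℕ) (i : Fin (m + 1)) (q : (E' × ℂ) × (Fin m → ℂ)) :
    E' × (Fin (m + 1) → ℂ) :=
  (q.1.1, (Fin.cons q.1.2 q.2 : Fin (m + 1) → ℂ) ∘ Equiv.swap 0 i)

omit [NormedAddCommGroup E'] [NormedSpace ℂ E'] in
/-- `finUnshuffle ∘ finShuffle = id`. [folklore] -/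
@[simp] theorem finUnshuffle_finShuffle (m : ℕ) (i : Fin (m + 1)) (p : E' × (Fin (m + 1) → ℂ)) :
    finUnshuffle E' m i (finShuffle E' m i p) = p := by
  ext1
  · rfl
  · funext j
    simp only [finShuffle, finUnshuffle, Function.comp_apply]
    have h : (Fin.cons (p.2 i) (Fin.tail (p.2 ∘ Equiv.swap 0 i)) : Fin (m + 1) → ℂ) =
        p.2 ∘ Equiv.swap 0 i := by
      conv_rhs => rw [← Fin.cons_self_tail (p.2 ∘ Equiv.swap 0 i)]
      simp
    rw [h, Function.comp_apply, Equiv.swap_apply_self]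

omit [NormedAddCommGroup E'] [NormedSpace ℂ E'] in
/-- `finShuffle ∘ finUnshuffle = id`. [folklore] -/
@[simp] theorem finShuffle_finUnshuffle (m : ℕ) (i : Fin (m + 1)) (q : (E' × ℂ) × (Fin m → ℂ)) :
    finShuffle E' m i (finUnshuffle E' m i q) = q := by
  ext1
  · ext1
    · rfl
    · simp [finShuffle, finUnshuffle]
  · funext j
    simp only [finShuffle, finUnshuffle, Fin.tail, Function.comp_apply, Equiv.swap_apply_self,
      Fin.cons_succ]

/-- `finShuffle` is complex-differentiable (it is linear). [folklore] -/
theorem differentiable_finShuffle (m : ℕ) (i : Fin (m + 1)) :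
    Differentiable ℂ (finShuffle E' m i) := by
  unfold finShuffle Fin.tail; fun_prop

/-- `finUnshuffle` is complex-differentiable (it is linear). [folklore] -/
theorem differentiable_finUnshuffle (m : ℕ) (i : Fin (m + 1)) :
    Differentiable ℂ (finUnshuffle E' m i) := by
  have h1 : Differentiable ℂ fun q : (E' × ℂ) × (Fin m → ℂ) =>
      (Fin.cons q.1.2 q.2 : Fin (m + 1) → ℂ) := by
    have h : ∀ q : (E' × ℂ) × (Fin m → ℂ),
        (Fin.cons q.1.2 q.2 : Fin (m + 1) → ℂ) =
          Fin.consEquivL ℂ (fun _ : Fin (m + 1) => ℂ) (q.1.2, q.2) := fun q => rfl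
    simp_rw [h]; fun_prop
  have h2 : Differentiable ℂ fun w : Fin (m + 1) → ℂ => w ∘ Equiv.swap 0 i :=
    differentiable_pi.2 fun j => by
      show Differentiable ℂ fun w : Fin (m + 1) → ℂ => w (Equiv.swap 0 i j)
      fun_prop
  unfold finUnshuffle
  exact differentiable_fst.fst.prodMk (h2.comp h1)

omit [NormedSpace ℂ E'] in
/-- `finShuffle` is continuous. [folklore] -/
theorem continuous_finShuffle (m : ℕ) (i : Fin (m + 1)) : Continuous (finShuffle E' m i) := by
  unfold finShuffle Fin.tail; fun_prop

/-- `finUnshuffle` is continuous. [folklore] -/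
theorem continuous_finUnshuffle (m : ℕ) (i : Fin (m + 1)) : Continuous (finUnshuffle E' m i) :=
  (differentiable_finUnshuffle m i).continuous

/-- **The shadow of an analytic set on a coordinate plane.** Let `f : E' × ℂ^{m+1} → ℂᴺ` be
holomorphic on an open `W ∋ a = (a', a'')` with `a''` isolated in (or not in) the zero set `Z` of
`f (a', ·)`, and let `i` be a fibre coordinate. Then near `a` the "shadow"
`{(z', w i) : (z', w) ∈ Z}` of `Z` on the `(z', w_i)`-plane lies in the zero set of a holomorphic
function `F` of `(z', t) ∈ E' × ℂ` whose slice `F (a', ·)` does not vanish identically near `a'' i`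
(a consequence of `isZeroSetAt_image_fst` applied to the projection forgetting the coordinates
`w_j`, `j ≠ i`). [cite: Chirka1989, §3.2 Thm.; §3.6] -/
theorem exists_shadow_equation {m N : ℕ} {f : E' × (Fin (m + 1) → ℂ) → (Fin N → ℂ)}
    {W : Set (E' × (Fin (m + 1) → ℂ))} (hW : IsOpen W) (hf : DifferentiableOn ℂ f W)
    {a : E' × (Fin (m + 1) → ℂ)} (ha : a ∈ W) (hiso : ∀ᶠ w in 𝓝[≠] a.2, f (a.1, w) ≠ 0)
    (i : Fin (m + 1)) :
    ∃ V : Set (E' × (Fin (m + 1) → ℂ)), IsOpen V ∧ a ∈ V ∧ V ⊆ W ∧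
      ∃ O : Set (E' × ℂ), IsOpen O ∧ (a.1, a.2 i) ∈ O ∧ ∃ F : E' × ℂ → ℂ,
        DifferentiableOn ℂ F O ∧ ¬ (fun t => F (a.1, t)) =ᶠ[𝓝 (a.2 i)] 0 ∧
        ∀ x ∈ V, f x = 0 → (x.1, x.2 i) ∈ O ∧ F (x.1, x.2 i) = 0 := by
  -- isolation radius `δ`
  obtain ⟨δ, hδ, hδiso⟩ : ∃ δ > 0, ∀ w, dist w a.2 < δ → w ≠ a.2 → f (a.1, w) ≠ 0 := by
    have := hiso
    rw [eventually_nhdsWithin_iff, Metric.eventually_nhds_iff] at this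
    obtain ⟨δ, hδ, h⟩ := this
    exact ⟨δ, hδ, fun w hw hne => h hw hne⟩
  -- shrink `W` to the isolation polydisc and transport
  set W₀ : Set (E' × (Fin (m + 1) → ℂ)) := W ∩ (univ ×ˢ ball a.2 δ) with hW₀
  have hW₀o : IsOpen W₀ := hW.inter (isOpen_univ.prod isOpen_ball)
  have haW₀ : a ∈ W₀ := ⟨ha, mem_univ _, mem_ball_self hδ⟩
  set W₂ : Set ((E' × ℂ) × (Fin m → ℂ)) := (finUnshuffle E' m i) ⁻¹' W₀ with hW₂
  have hW₂o : IsOpen W₂ := hW₀o.preimage (continuous_finUnshuffle m i)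
  set f₂ : (E' × ℂ) × (Fin m → ℂ) → (Fin N → ℂ) := f ∘ finUnshuffle E' m i with hf₂
  have hf₂d : DifferentiableOn ℂ f₂ W₂ :=
    (hf.mono inter_subset_left).comp (differentiable_finUnshuffle m i).differentiableOn
      fun q hq => hq
  set a₂ := finShuffle E' m i a with ha₂
  have ha₂W : a₂ ∈ W₂ := by
    show finUnshuffle E' m i (finShuffle E' m i a) ∈ W₀
    rw [finUnshuffle_finShuffle]; exact haW₀
  -- isolation in the new fibre
  have hpt : ∀ u, finUnshuffle E' m i (a₂.1, u) = (a.1, (finUnshuffle E' m i (a₂.1, u)).2) :=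
    fun u => Prod.ext rfl rfl
  have hι0 : (finUnshuffle E' m i (a₂.1, a₂.2)).2 = a.2 := by
    rw [Prod.mk.eta, ha₂, finUnshuffle_finShuffle]
  have hιinj : ∀ u, (finUnshuffle E' m i (a₂.1, u)).2 = a.2 → u = a₂.2 := by
    intro u h
    have h1 : finShuffle E' m i (finUnshuffle E' m i (a₂.1, u)) = finShuffle E' m i a := by
      rw [hpt u, h]
    rw [finShuffle_finUnshuffle] at h1
    exact congrArg Prod.snd h1
  have hiso₂ : ∀ᶠ u in 𝓝[≠] a₂.2, f₂ (a₂.1, u) ≠ 0 := by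
    have hc : Continuous fun u : Fin m → ℂ => (finUnshuffle E' m i (a₂.1, u)).2 :=
      continuous_snd.comp ((continuous_finUnshuffle m i).comp (by fun_prop))
    have hmem : ∀ᶠ u in 𝓝 a₂.2, dist (finUnshuffle E' m i (a₂.1, u)).2 a.2 < δ := by
      have h := hc.continuousAt (x := a₂.2)
      rw [ContinuousAt, hι0] at h
      exact h.eventually (Metric.eventually_nhds_iff.2 ⟨δ, hδ, fun _ h => h⟩)
    rw [eventually_nhdsWithin_iff]
    refine hmem.mono fun u hu hne => ?_
    have hne' : (finUnshuffle E' m i (a₂.1, u)).2 ≠ a.2 := fun h => hne (hιinj u h)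
    have h1 := hδiso _ hu hne'
    show f (finUnshuffle E' m i (a₂.1, u)) ≠ 0
    rw [hpt u]; exact h1
  obtain ⟨V₂, hV₂o, haV₂, hV₂W, O, hOo, haO, M, G, hGd, hZO⟩ :=
    isZeroSetAt_image_fst m hW₂o hf₂d ha₂W hiso₂
  -- the shadow near `(a', a'' i)` is `{a'' i}` on the slice `z' = a'`: some component of `G` is
  -- not identically zero there
  change (a.1, a.2 i) ∈ O at haO
  change Prod.fst '' (V₂ ∩ f₂ ⁻¹' {0}) ∩ O = O ∩ G ⁻¹' {0} at hZO
  have hisoG : ∀ᶠ t in 𝓝[≠] (a.2 i), G (a.1, t) ≠ 0 := by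
    have hO' : ∀ᶠ t in 𝓝 (a.2 i), (a.1, t) ∈ O :=
      (by fun_prop : Continuous fun t : ℂ => ((a.1, t) : E' × ℂ)).continuousAt.eventually
        (hOo.mem_nhds haO)
    rw [eventually_nhdsWithin_iff]
    refine hO'.mono fun t htO htne hG0 => ?_
    have hmem : (a.1, t) ∈ O ∩ G ⁻¹' {0} := ⟨htO, hG0⟩
    rw [← hZO] at hmem
    obtain ⟨⟨q, ⟨hqV, hq0⟩, hq1⟩, -⟩ := hmem
    -- `q = ((a', t), u)` with `f (unshuffle q) = 0` and `unshuffle q` in the isolation polydisc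
    have hqW : finUnshuffle E' m i q ∈ W₀ := hV₂W hqV
    have hfq : f (finUnshuffle E' m i q) = 0 := hq0
    have hq2 : (finUnshuffle E' m i q).1 = a.1 := by
      show q.1.1 = a.1; rw [hq1]
    have hne : (finUnshuffle E' m i q).2 ≠ a.2 := by
      intro h
      apply htne
      have : (finShuffle E' m i (finUnshuffle E' m i q)).1.2 = (finShuffle E' m i a).1.2 := by
        show (finUnshuffle E' m i q).2 i = a.2 i; rw [h]
      rw [finShuffle_finUnshuffle] at this
      rw [hq1] at this
      exact this
    have hdist : dist (finUnshuffle E' m i q).2 a.2 < δ := hqW.2.2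
    have := hδiso _ hdist hne
    rw [← hq2] at this
    exact this hfq
  obtain ⟨l, hl⟩ := exists_apply_not_eventuallyEq_zero hisoG
  -- the neighbourhood `V`
  set V : Set (E' × (Fin (m + 1) → ℂ)) :=
    (finShuffle E' m i) ⁻¹' (V₂ ∩ Prod.fst ⁻¹' O) with hV
  refine ⟨V, (hV₂o.inter (hOo.preimage continuous_fst)).preimage (continuous_finShuffle m i),
    ⟨haV₂, haO⟩, fun x hx => ?_, O, hOo, haO, fun y => G y l, differentiableOn_pi.1 hGd l, hl,
    fun x hx hfx => ⟨hx.2, ?_⟩⟩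
  · have := hV₂W hx.1
    have h : finUnshuffle E' m i (finShuffle E' m i x) ∈ W₀ := this
    rw [finUnshuffle_finShuffle] at h
    exact h.1
  · have hmem : (x.1, x.2 i) ∈ Prod.fst '' (V₂ ∩ f₂ ⁻¹' {0}) ∩ O := by
      refine ⟨⟨finShuffle E' m i x, ⟨hx.1, ?_⟩, rfl⟩, hx.2⟩
      show f (finUnshuffle E' m i (finShuffle E' m i x)) = 0
      rw [finUnshuffle_finShuffle]; exact hfx
    rw [hZO] at hmem
    have := hmem.2
    rw [mem_preimage, mem_singleton_iff] at this
    exact congrFun this l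

end Elimination

/-! ## Analytic covers: the generic structure of a finite projection (Chirka §3.7, weak form) -/

section Cover

variable {E' : Type*} [NormedAddCommGroup E'] [NormedSpace ℂ E']

/-- **The norm trick** (elimination by norms instead of resultants). Let `D` be a finite set with at
most `K` elements and `v : D → ℂᴺ`. Then all the "norms" `∏_{a ∈ D} Σ_l t^l v_a,l` vanish for the
`K (N - 1) + 1` values `t = 0, 1, …, K (N - 1)` iff some `v_a = 0`: by the pigeonhole principle one
`a` kills `Σ_l t^l v_a,l` for `N` distinct values of `t`, whence `v_a = 0` by Vandermonde.
[Chirka, *Complex Analytic Sets*, §3.2 (proof), §4.2] [folklore] -/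
theorem prod_sum_pow_mul_eq_zero_iff {α : Type*} [DecidableEq α] {N K : ℕ} {D : Finset α}
    (hD : D.card ≤ K) (v : α → Fin N → ℂ) :
    (∀ i : Fin (K * (N - 1) + 1), ∏ a ∈ D, (∑ l : Fin N, ((i : ℕ) : ℂ) ^ (l : ℕ) * v a l) = 0) ↔
      ∃ a ∈ D, v a = 0 := by
  classical
  constructor
  · intro h
    have hex : ∀ i : Fin (K * (N - 1) + 1), ∃ a ∈ D,
        ∑ l : Fin N, ((i : ℕ) : ℂ) ^ (l : ℕ) * v a l = 0 := fun i =>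
      Finset.prod_eq_zero_iff.1 (h i)
    choose φ hφmem hφzero using hex
    obtain ⟨a, haD, hcard⟩ := Finset.exists_lt_card_fiber_of_mul_lt_card_of_maps_to
      (s := Finset.univ) (t := D) (f := φ) (n := N - 1) (fun i _ => hφmem i) (by
        rw [Finset.card_univ, Fintype.card_fin]
        calc D.card * (N - 1) ≤ K * (N - 1) := Nat.mul_le_mul_right _ hD
          _ < K * (N - 1) + 1 := Nat.lt_succ_self _)
    set fib := Finset.univ.filter fun i : Fin (K * (N - 1) + 1) => φ i = a with hfib
    have hN : N ≤ fib.card := by omega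
    obtain ⟨s, hs, hscard⟩ := Finset.exists_subset_card_eq hN
    set e := s.equivFinOfCardEq hscard with he
    set t : Fin N → ℂ := fun j => (((e.symm j : Fin (K * (N - 1) + 1)) : ℕ) : ℂ) with ht_def
    have ht : Function.Injective t := by
      intro j j' hjj
      simp only [ht_def, Nat.cast_inj] at hjj
      exact e.symm.injective (Subtype.ext (Fin.ext hjj))
    refine ⟨a, haD, eq_zero_of_sum_pow_mul_eq_zero ht fun j => ?_⟩
    have hj : (e.symm j : Fin (K * (N - 1) + 1)) ∈ fib := hs (e.symm j).2
    have h0 := hφzero (e.symm j)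
    rw [(Finset.mem_filter.1 hj).2] at h0
    simpa [ht_def] using h0
  · rintro ⟨a, haD, hva⟩ i
    exact Finset.prod_eq_zero haD (by simp [hva])

omit [NormedSpace ℂ E'] in
/-- **Common non-vanishing point.** Finitely many functions continuous on an open set `U`, none of
which vanishes identically near any point of `U`, have a common non-zero point in every nonempty
open subset of `U` (indeed in `U` itself). [folklore] -/
theorem exists_forall_ne_zero_of_not_eventuallyEq {ι Y : Type*} [NormedAddCommGroup Y]
    (s : Finset ι) {g : ι → E' → Y} {U : Set E'} (hU : IsOpen U) (hne : U.Nonempty)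
    (hg : ∀ i ∈ s, ContinuousOn (g i) U) (h : ∀ i ∈ s, ∀ z ∈ U, ¬ g i =ᶠ[𝓝 z] 0) :
    ∃ z ∈ U, ∀ i ∈ s, g i z ≠ 0 := by
  classical
  induction s using Finset.induction_on with
  | empty => exact ⟨hne.some, hne.some_mem, fun i hi => absurd hi (Finset.notMem_empty i)⟩
  | insert j s hj ih =>
    obtain ⟨z, hzU, hz⟩ := ih (fun i hi => hg i (Finset.mem_insert_of_mem hi))
      fun i hi => h i (Finset.mem_insert_of_mem hi)
    -- the open set where the previous functions are all nonzero
    set U' : Set E' := U ∩ ⋂ i ∈ s, (U ∩ (g i) ⁻¹' {0}ᶜ) with hU'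
    have hU'o : IsOpen U' := hU.inter (isOpen_biInter_finset fun i hi =>
      (hg i (Finset.mem_insert_of_mem hi)).isOpen_inter_preimage hU isOpen_compl_singleton)
    have hzU' : z ∈ U' := ⟨hzU, mem_iInter₂.2 fun i hi => ⟨hzU, hz i hi⟩⟩
    have hfr : ∃ᶠ x in 𝓝 z, g j x ≠ 0 := by
      have := h j (Finset.mem_insert_self j s) z hzU
      simpa [Filter.EventuallyEq, Filter.not_eventually] using this
    obtain ⟨x, hxj, hxU'⟩ := (hfr.and_eventually (hU'o.mem_nhds hzU')).exists
    refine ⟨x, hxU'.1, fun i hi => ?_⟩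
    rcases Finset.mem_insert.1 hi with rfl | hi
    · exact hxj
    · exact ((mem_iInter₂.1 hxU'.2) i hi).2

/-! ### The set-up of an analytic cover at a point with isolated fibre -/

/-- **Set-up of the local analytic cover** of the zero set `Z` of `f : E' × ℂ^{m+1} → ℂᴺ` over the
polydisc `ball a' ε × ball a'' r`: `f` is holomorphic and bounded by `C` on the open polydisc; for
each fibre coordinate `i` a "shadow" function `F i (z', t)` satisfies the Weierstrass hypotheses on
`ball a' ε × {|t - a'' i| < RR i}` with the circle `|t - a'' i| = rr i`, `rr i ≤ r`; and every zero
`x = (z', w)` of `f` in the *closed* polydisc has `|w i - a'' i| < rr i` and `F i (z', w i) = 0` for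
all `i` (so the projection `Z → ball a' ε` is proper with finite fibres, contained in the finite
sets `∏_i {roots of F i (z', ·)}`). [Chirka, *Complex Analytic Sets*, §3.1, §3.4–3.7] [folklore] -/
structure CoverSetup {m N : ℕ} (f : E' × (Fin (m + 1) → ℂ) → (Fin N → ℂ)) (a' : E')
    (a'' : Fin (m + 1) → ℂ) (ε r C : ℝ) (F : Fin (m + 1) → E' × ℂ → ℂ)
    (rr RR : Fin (m + 1) → ℝ) : Prop where
  ε_pos : 0 < ε
  r_pos : 0 < r
  differentiableOn : DifferentiableOn ℂ f (ball a' ε ×ˢ ball a'' r)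
  norm_le : ∀ x ∈ ball a' ε ×ˢ ball a'' r, ‖f x‖ ≤ C
  wd : ∀ i, WeierstrassData (F i) (ball a' ε) (a'' i) (rr i) (RR i)
  rr_le : ∀ i, rr i ≤ r
  zero : ∀ x ∈ ball a' ε ×ˢ closedBall a'' r, f x = 0 →
    ∀ i, x.2 i ∈ ball (a'' i) (rr i) ∧ F i (x.1, x.2 i) = 0

/-- **Existence of the set-up** at a point `a = (a', a'')` where `a''` is isolated in (or not in)
the zero set of `f (a', ·)`: shadow equations (`exists_shadow_equation`) for every fibre
coordinate, Weierstrass set-up for each (`exists_weierstrassData`) with root discs so small that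
the box `∏_i {|w i - a'' i| < rr i}` lies in `ball a'' r`, and a base ball so small that all zeros
over it lie in the box (closedness of the zero set and compactness of `closedBall a'' r ∖ box`).
[cite: Chirka1989, §3.1 (5), §3.4 Lemma 1] -/
theorem exists_coverSetup {m N : ℕ} {f : E' × (Fin (m + 1) → ℂ) → (Fin N → ℂ)}
    {W : Set (E' × (Fin (m + 1) → ℂ))} (hW : IsOpen W) (hf : DifferentiableOn ℂ f W)
    {a : E' × (Fin (m + 1) → ℂ)} (ha : a ∈ W) (hiso : ∀ᶠ w in 𝓝[≠] a.2, f (a.1, w) ≠ 0) :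
    ∃ (ε r C : ℝ) (F : Fin (m + 1) → E' × ℂ → ℂ) (rr RR : Fin (m + 1) → ℝ),
      CoverSetup f a.1 a.2 ε r C F rr RR ∧ ball a.1 ε ×ˢ closedBall a.2 r ⊆ W := by
  classical
  -- isolation radius
  obtain ⟨δ₁, hδ₁, hiso₁⟩ : ∃ δ > 0, ∀ w, dist w a.2 < δ → w ≠ a.2 → f (a.1, w) ≠ 0 := by
    have := hiso
    rw [eventually_nhdsWithin_iff, Metric.eventually_nhds_iff] at this
    obtain ⟨δ, hδ, h⟩ := this
    exact ⟨δ, hδ, fun w hw hne => h hw hne⟩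
  -- shadow equations
  choose V hVo haV hVW O hOo haO F hFd hFne hFzero using
    fun i => exists_shadow_equation hW hf ha hiso i
  -- a polydisc around `a` inside `W ∩ ⋂ V i` on which `f` is bounded
  obtain ⟨δ₂, hδ₂, hδ₂sub, C, hC⟩ : ∃ δ > 0, ball a δ ⊆ W ∩ ⋂ i, V i ∧
      ∃ C : ℝ, ∀ x ∈ ball a δ, ‖f x‖ ≤ C := by
    have hopen : IsOpen (W ∩ ⋂ i, V i) := hW.inter (isOpen_iInter_of_finite hVo)
    have hmem : a ∈ W ∩ ⋂ i, V i := ⟨ha, mem_iInter.2 haV⟩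
    have hcont : ContinuousAt f a := (hf.differentiableAt (hW.mem_nhds ha)).continuousAt
    have hbd : ∀ᶠ x in 𝓝 a, ‖f x‖ ≤ ‖f a‖ + 1 := by
      have := hcont.norm.eventually (Iio_mem_nhds (lt_add_one ‖f a‖))
      exact this.mono fun x hx => le_of_lt hx
    have hint : (W ∩ ⋂ i, V i) ∩ {x | ‖f x‖ ≤ ‖f a‖ + 1} ∈ 𝓝 a :=
      Filter.inter_mem (hopen.mem_nhds hmem) hbd
    obtain ⟨δ, hδ, hball⟩ := Metric.mem_nhds_iff.1 hint
    exact ⟨δ, hδ, fun x hx => (hball hx).1, ‖f a‖ + 1, fun x hx => (hball hx).2⟩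
  -- the fibre radius
  set r : ℝ := min δ₁ δ₂ / 2 with hr
  have hr0 : 0 < r := by positivity
  have hrδ₁ : r < δ₁ := by
    have : min δ₁ δ₂ ≤ δ₁ := min_le_left _ _
    rw [hr]; linarith
  have hrδ₂ : r < δ₂ := by
    have : min δ₁ δ₂ ≤ δ₂ := min_le_right _ _
    rw [hr]; linarith
  -- Weierstrass set-up for the shadows, with root discs of radius `< r`
  have hWD : ∀ i, ∃ ε rr RR : ℝ, 0 < ε ∧ ball a.1 ε ×ˢ ball (a.2 i) RR ⊆ O i ∩ univ ×ˢ ball (a.2 i) r ∧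
      WeierstrassData (F i) (ball a.1 ε) (a.2 i) rr RR := by
    intro i
    have hΩ : IsOpen (O i ∩ univ ×ˢ ball (a.2 i) r) := (hOo i).inter (isOpen_univ.prod isOpen_ball)
    obtain ⟨ε, rr, RR, hε, hsub, hwd, -, -⟩ := exists_weierstrassData hΩ
      ((hFd i).mono inter_subset_left) ⟨haO i, mem_univ _, mem_ball_self hr0⟩ (hFne i)
    exact ⟨ε, rr, RR, hε, hsub, hwd⟩
  choose εi rr RR hεi hsubi hwd using hWD
  have hrr : ∀ i, rr i < r := by
    intro i
    have hRR : RR i ≤ r := by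
      by_contra hlt
      rw [not_le] at hlt
      have hmem : (a.1, a.2 i + r) ∈ ball a.1 (εi i) ×ˢ ball (a.2 i) (RR i) :=
        mk_mem_prod (mem_ball_self (hεi i)) (by simpa [mem_ball, abs_of_pos hr0] using hlt)
      have := ((hsubi i) hmem).2.2
      simp [mem_ball, abs_of_pos hr0] at this
    exact (hwd i).lt.trans_le hRR
  -- tube lemma: over a small base ball all zeros lie in the box
  set K : Set (Fin (m + 1) → ℂ) :=
    closedBall a.2 r ∩ ⋃ i, {w | rr i ≤ dist (w i) (a.2 i)} with hK
  have hKc : IsCompact K := (isCompact_closedBall _ _).inter_right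
    (isClosed_iUnion_of_finite fun i => isClosed_le continuous_const
      ((continuous_apply i).dist continuous_const))
  set Nset : Set (E' × (Fin (m + 1) → ℂ)) := W ∩ f ⁻¹' {0}ᶜ with hNset
  have hNo : IsOpen Nset := hf.continuousOn.isOpen_inter_preimage hW isOpen_compl_singleton
  have hKN : ({a.1} : Set E') ×ˢ K ⊆ Nset := by
    rintro ⟨z, w⟩ ⟨hz, hw⟩
    rw [mem_singleton_iff] at hz
    subst hz
    have hwr : dist w a.2 ≤ r := mem_closedBall.1 hw.1
    obtain ⟨i, hi⟩ := mem_iUnion.1 hw.2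
    have hne : w ≠ a.2 := by
      rintro rfl
      have : rr i ≤ 0 := by simpa using hi
      exact absurd this (not_le.2 (hwd i).pos)
    refine ⟨(hδ₂sub ?_).1, hiso₁ w (hwr.trans_lt hrδ₁) hne⟩
    rw [mem_ball, Prod.dist_eq, dist_self]
    exact max_lt hδ₂ (hwr.trans_lt hrδ₂)
  obtain ⟨V', T, hV'o, -, haV', hKT, hVT⟩ :=
    generalized_tube_lemma isCompact_singleton hKc hNo hKN
  obtain ⟨ε₀, hε₀, hε₀V⟩ := Metric.isOpen_iff.1 hV'o a.1 (haV' (mem_singleton a.1))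
  -- the base radius
  set ε : ℝ := min (min ε₀ δ₂) (Finset.univ.inf' Finset.univ_nonempty εi) with hε
  have hε0 : 0 < ε := lt_min (lt_min hε₀ hδ₂) ((Finset.lt_inf'_iff _).2 fun i _ => hεi i)
  have hεε₀ : ε ≤ ε₀ := (min_le_left _ _).trans (min_le_left _ _)
  have hεδ₂ : ε ≤ δ₂ := (min_le_left _ _).trans (min_le_right _ _)
  have hεi' : ∀ i, ε ≤ εi i := fun i => (min_le_right _ _).trans (Finset.inf'_le _ (Finset.mem_univ i))
  have hpoly : ball a.1 ε ×ˢ closedBall a.2 r ⊆ ball a δ₂ := by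
    rintro ⟨z, w⟩ ⟨hz, hw⟩
    rw [mem_ball, Prod.dist_eq]
    exact max_lt ((mem_ball.1 hz).trans_le hεδ₂) ((mem_closedBall.1 hw).trans_lt hrδ₂)
  refine ⟨ε, r, C, F, rr, RR, ⟨hε0, hr0, ?_, ?_, fun i => (hwd i).mono isOpen_ball
    (ball_subset_ball (hεi' i)), fun i => (hrr i).le, ?_⟩, fun x hx => (hδ₂sub (hpoly hx)).1⟩
  · exact hf.mono fun x hx => (hδ₂sub (hpoly ⟨hx.1, ball_subset_closedBall hx.2⟩)).1
  · exact fun x hx => hC x (hpoly ⟨hx.1, ball_subset_closedBall hx.2⟩)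
  · intro x hx hfx
    -- `x.2 ∉ K`
    have hxK : x.2 ∉ K := fun hxK => by
      have : x ∈ Nset := hVT (mk_mem_prod (hε₀V (ball_subset_ball hεε₀ hx.1)) (hKT hxK))
      exact this.2 hfx
    have hbox : ∀ i, x.2 i ∈ ball (a.2 i) (rr i) := by
      intro i
      by_contra hi
      rw [mem_ball, not_lt] at hi
      exact hxK ⟨hx.2, mem_iUnion.2 ⟨i, hi⟩⟩
    intro i
    refine ⟨hbox i, ?_⟩
    have hxV : x ∈ V i := (mem_iInter.1 (hδ₂sub (hpoly hx)).2) i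
    exact (hFzero i x hxV hfx).2

/-! ### The candidate fibres: boxes of roots of the shadow functions -/

open Classical in
/-- The finite set `∏_i {roots of F i (z', ·) in |t - a'' i| < rr i}` of tuples of roots of the
shadow functions: it contains the fibre over `z'` of the zero set. [folklore] -/
noncomputable def rootBox {m : ℕ} (F : Fin (m + 1) → E' × ℂ → ℂ) (a'' : Fin (m + 1) → ℂ)
    (rr : Fin (m + 1) → ℝ) (z' : E') : Finset (Fin (m + 1) → ℂ) :=
  Fintype.piFinset fun i => (sliceRoots (F i) (a'' i) (rr i) z').toFinset

omit [NormedAddCommGroup E'] [NormedSpace ℂ E'] in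
/-- Membership in the root box: every coordinate is a root of the corresponding shadow function.
[folklore] -/
theorem mem_rootBox_iff {m : ℕ} {F : Fin (m + 1) → E' × ℂ → ℂ} {a'' : Fin (m + 1) → ℂ}
    {rr : Fin (m + 1) → ℝ} {z' : E'} {w : Fin (m + 1) → ℂ} :
    w ∈ rootBox F a'' rr z' ↔ ∀ i, w i ∈ sliceRoots (F i) (a'' i) (rr i) z' := by
  classical
  simp [rootBox, Fintype.mem_piFinset, Multiset.mem_toFinset]

namespace CoverSetup

variable {m N : ℕ} {f : E' × (Fin (m + 1) → ℂ) → (Fin N → ℂ)} {a' : E'} {a'' : Fin (m + 1) → ℂ}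
  {ε r C : ℝ} {F : Fin (m + 1) → E' × ℂ → ℂ} {rr RR : Fin (m + 1) → ℝ}

/-- Zeros of `f` in the closed polydisc lie in the root box. [folklore] -/
theorem mem_rootBox_of_zero (hS : CoverSetup f a' a'' ε r C F rr RR) {x : E' × (Fin (m + 1) → ℂ)}
    (hx : x ∈ ball a' ε ×ˢ closedBall a'' r) (hfx : f x = 0) : x.2 ∈ rootBox F a'' rr x.1 := by
  rw [mem_rootBox_iff]
  intro i
  obtain ⟨hball, hF⟩ := hS.zero x hx hfx i
  exact (mem_rootMultiset_iff ((hS.wd i).differentiableOn_slice hx.1) (hS.wd i).pos (hS.wd i).lt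
    ((hS.wd i).ne_zero x.1 hx.1)).2 ⟨hball, hF⟩

omit [NormedAddCommGroup E'] [NormedSpace ℂ E'] in
/-- Points of the root box lie in the box `∏_i {|w i - a'' i| < rr i}`. [folklore] -/
theorem mem_ball_apply_of_mem_rootBox {z' : E'} {w : Fin (m + 1) → ℂ}
    (hw : w ∈ rootBox F a'' rr z') (i : Fin (m + 1)) : w i ∈ ball (a'' i) (rr i) :=
  mem_ball_of_mem_rootMultiset (mem_rootBox_iff.1 hw i)

/-- Points of the root box lie in the open polydisc `ball a'' r`. [folklore] -/
theorem mem_ball_of_mem_box (hS : CoverSetup f a' a'' ε r C F rr RR) {w : Fin (m + 1) → ℂ}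
    (hw : ∀ i, w i ∈ ball (a'' i) (rr i)) : w ∈ ball a'' r := by
  rw [mem_ball, dist_pi_lt_iff hS.r_pos]
  exact fun i => (mem_ball.1 (hw i)).trans_le (hS.rr_le i)

/-- Points of the root box lie in the open polydisc `ball a'' r`. [folklore] -/
theorem mem_ball_of_mem_rootBox (hS : CoverSetup f a' a'' ε r C F rr RR) {z' : E'}
    {w : Fin (m + 1) → ℂ} (hw : w ∈ rootBox F a'' rr z') : w ∈ ball a'' r :=
  hS.mem_ball_of_mem_box (mem_ball_apply_of_mem_rootBox hw)

/-- **Properness**: zeros in the closed polydisc lie in the open polydisc. [folklore] -/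
theorem mem_ball_of_zero (hS : CoverSetup f a' a'' ε r C F rr RR) {x : E' × (Fin (m + 1) → ℂ)}
    (hx : x ∈ ball a' ε ×ˢ closedBall a'' r) (hfx : f x = 0) : x.2 ∈ ball a'' r :=
  hS.mem_ball_of_mem_rootBox (hS.mem_rootBox_of_zero hx hfx)

/-- **Finite fibres**: over each base point the zero set has finitely many points in the closed
polydisc. [cite: Chirka1989, §3.2 Thm.] -/
theorem finite_zeros (hS : CoverSetup f a' a'' ε r C F rr RR) {z' : E'} (hz' : z' ∈ ball a' ε) :
    {w | w ∈ closedBall a'' r ∧ f (z', w) = 0}.Finite :=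
  (rootBox F a'' rr z').finite_toSet.subset fun w hw =>
    hS.mem_rootBox_of_zero (x := (z', w)) (mk_mem_prod hz' hw.1) hw.2

/-- The bound `K = ∏_i k_i` on the size of the root boxes (`k_i` the number of roots of
`F i (a', ·)`). [folklore] -/
noncomputable def boxBound (_hS : CoverSetup f a' a'' ε r C F rr RR) : ℕ :=
  ∏ i, (sliceRoots (F i) (a'' i) (rr i) a').card

/-- The root boxes have at most `K = ∏_i k_i` points. [folklore] -/
theorem card_rootBox_le (hS : CoverSetup f a' a'' ε r C F rr RR) {z' : E'} (hz' : z' ∈ ball a' ε) :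
    (rootBox F a'' rr z').card ≤ hS.boxBound := by
  classical
  rw [rootBox, Fintype.card_piFinset, boxBound]
  refine Finset.prod_le_prod' fun i _ => ?_
  rw [← (hS.wd i).card_sliceRoots_eq (convex_ball _ _).isPreconnected (mem_ball_self hS.ε_pos)
    hz']
  exact Multiset.toFinset_card_le _

/-- `f` is continuous on the open polydisc. [folklore] -/
theorem norm_apply_le (hS : CoverSetup f a' a'' ε r C F rr RR) {z' : E'} (hz' : z' ∈ ball a' ε)
    {w : Fin (m + 1) → ℂ} (hw : w ∈ rootBox F a'' rr z') (l : Fin N) : ‖f (z', w) l‖ ≤ max C 0 :=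
  ((norm_le_pi_norm _ l).trans (hS.norm_le (z', w) (mk_mem_prod hz' (hS.mem_ball_of_mem_rootBox hw)))).trans
    (le_max_left _ _)

end CoverSetup

/-! ### Sheets: holomorphic root functions over a ball off the discriminant loci -/

/-- **Sheet data** over a set `B` of base points: for each fibre coordinate `i`, finitely many
holomorphic functions `β i j` on `B` with pairwise distinct values in the root disc
`|t - a'' i| < rr i` whose values are exactly the roots of `F i (z', ·)`; the *sheets* over `B` are
the maps `z' ↦ (β i (J i) z')_i` (`sheet β J`). [Chirka, *Complex Analytic Sets*, §1.3, §3.7]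
[folklore] -/
structure Sheets {m : ℕ} (F : Fin (m + 1) → E' × ℂ → ℂ) (a'' : Fin (m + 1) → ℂ)
    (rr : Fin (m + 1) → ℝ) (B : Set E') (s : Fin (m + 1) → ℕ)
    (β : ∀ i, Fin (s i) → E' → ℂ) : Prop where
  differentiableOn : ∀ i j, DifferentiableOn ℂ (β i j) B
  ne : ∀ z' ∈ B, ∀ i (j j' : Fin (s i)), j ≠ j' → β i j z' ≠ β i j' z'
  mem_ball : ∀ z' ∈ B, ∀ i j, β i j z' ∈ ball (a'' i) (rr i)
  mem_iff : ∀ z' ∈ B, ∀ i t, t ∈ sliceRoots (F i) (a'' i) (rr i) z' ↔ ∃ j, t = β i j z'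

/-- The sheet with index `J`: `z' ↦ (β i (J i) z')_i`. [folklore] -/
def sheet {m : ℕ} {s : Fin (m + 1) → ℕ} (β : ∀ i, Fin (s i) → E' → ℂ) (J : ∀ i, Fin (s i))
    (z' : E') : Fin (m + 1) → ℂ :=
  fun i => β i (J i) z'

namespace Sheets

variable {m : ℕ} {F : Fin (m + 1) → E' × ℂ → ℂ} {a'' : Fin (m + 1) → ℂ} {rr : Fin (m + 1) → ℝ}
  {B : Set E'} {s : Fin (m + 1) → ℕ} {β : ∀ i, Fin (s i) → E' → ℂ}

/-- Sheets are holomorphic. [folklore] -/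
theorem differentiableOn_sheet (hSh : Sheets F a'' rr B s β) (J : ∀ i, Fin (s i)) :
    DifferentiableOn ℂ (sheet β J) B :=
  differentiableOn_pi.2 fun i => hSh.differentiableOn i (J i)

/-- Distinct sheet indices give distinct points in every fibre. [folklore] -/
theorem sheet_injective (hSh : Sheets F a'' rr B s β) {z' : E'} (hz' : z' ∈ B)
    {J J' : ∀ i, Fin (s i)} (h : sheet β J z' = sheet β J' z') : J = J' := by
  funext i
  by_contra hne
  exact hSh.ne z' hz' i (J i) (J' i) hne (congrFun h i)

/-- Over `B` the root box is the set of values of the sheets. [folklore] -/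
theorem mem_rootBox_iff_sheet (hSh : Sheets F a'' rr B s β) {z' : E'} (hz' : z' ∈ B)
    {w : Fin (m + 1) → ℂ} : w ∈ rootBox F a'' rr z' ↔ ∃ J, w = sheet β J z' := by
  rw [mem_rootBox_iff]
  constructor
  · intro h
    choose J hJ using fun i => (hSh.mem_iff z' hz' i (w i)).1 (h i)
    exact ⟨J, funext hJ⟩
  · rintro ⟨J, rfl⟩ i
    exact (hSh.mem_iff z' hz' i _).2 ⟨J i, rfl⟩

/-- The values of the sheets lie in the root boxes. [folklore] -/
theorem sheet_mem_rootBox (hSh : Sheets F a'' rr B s β) {z' : E'} (hz' : z' ∈ B)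
    (J : ∀ i, Fin (s i)) : sheet β J z' ∈ rootBox F a'' rr z' :=
  (hSh.mem_rootBox_iff_sheet hz').2 ⟨J, rfl⟩

/-- The root box over `z' ∈ B` is the (injective) image of the set of sheet indices. [folklore] -/
theorem rootBox_eq_image (hSh : Sheets F a'' rr B s β) {z' : E'} (hz' : z' ∈ B) :
    rootBox F a'' rr z' = Finset.univ.image fun J => sheet β J z' := by
  classical
  ext w
  rw [hSh.mem_rootBox_iff_sheet hz', Finset.mem_image]
  constructor
  · rintro ⟨J, rfl⟩; exact ⟨J, Finset.mem_univ _, rfl⟩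
  · rintro ⟨J, -, rfl⟩; exact ⟨J, rfl⟩

/-- Restriction of sheet data to a smaller base set. [folklore] -/
theorem mono (hSh : Sheets F a'' rr B s β) {B' : Set E'} (h : B' ⊆ B) : Sheets F a'' rr B' s β where
  differentiableOn i j := (hSh.differentiableOn i j).mono h
  ne z' hz' := hSh.ne z' (h hz')
  mem_ball z' hz' := hSh.mem_ball z' (h hz')
  mem_iff z' hz' := hSh.mem_iff z' (h hz')

end Sheets

namespace CoverSetup

variable {m N : ℕ} {f : E' × (Fin (m + 1) → ℂ) → (Fin N → ℂ)} {a' : E'} {a'' : Fin (m + 1) → ℂ}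
  {ε r C : ℝ} {F : Fin (m + 1) → E' × ℂ → ℂ} {rr RR : Fin (m + 1) → ℝ}

/-- **Discriminants and sheets**: for each fibre coordinate a holomorphic `μ i ≢ 0` on the base
ball (the Hankel discriminant of `F i`) such that around every point where all `μ i ≠ 0` there is
sheet data on a ball. [cite: Chirka1989, §1.3 (p. 7), §3.7 Thm.] -/
theorem exists_disc (hS : CoverSetup f a' a'' ε r C F rr RR) :
    ∃ μ : Fin (m + 1) → E' → ℂ, (∀ i, DifferentiableOn ℂ (μ i) (ball a' ε)) ∧
      (∀ i, ∃ z' ∈ ball a' ε, μ i z' ≠ 0) ∧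
      ∀ z₀ ∈ ball a' ε, (∀ i, μ i z₀ ≠ 0) → ∃ δ > 0, ball z₀ δ ⊆ ball a' ε ∧
        ∃ (s : Fin (m + 1) → ℕ) (β : ∀ i, Fin (s i) → E' → ℂ), Sheets F a'' rr (ball z₀ δ) s β := by
  choose μ hμd hμne hμroots using fun i => (hS.wd i).exists_discriminant_roots
    (convex_ball _ _).isPreconnected ⟨a', mem_ball_self hS.ε_pos⟩
  refine ⟨μ, hμd, hμne, fun z₀ hz₀ hμ0 => ?_⟩
  choose δ hδ hδsub s β hβd hβne hβmem hβiff using fun i => hμroots i z₀ hz₀ (hμ0 i)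
  set δ₀ := Finset.univ.inf' Finset.univ_nonempty δ with hδ₀
  have hδ₀pos : 0 < δ₀ := (Finset.lt_inf'_iff _).2 fun i _ => hδ i
  have hδ₀le : ∀ i, δ₀ ≤ δ i := fun i => Finset.inf'_le _ (Finset.mem_univ i)
  refine ⟨δ₀, hδ₀pos, (ball_subset_ball (hδ₀le 0)).trans (hδsub 0), s, β,
    { differentiableOn := fun i j => (hβd i j).mono (ball_subset_ball (hδ₀le i))
      ne := fun z' hz' i j j' hjj => hβne i z' (ball_subset_ball (hδ₀le i) hz') j j' hjj
      mem_ball := fun z' hz' i j => hβmem i z' (ball_subset_ball (hδ₀le i) hz') j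
      mem_iff := fun z' hz' i t => hβiff i z' (ball_subset_ball (hδ₀le i) hz') t }⟩

/-- Along a sheet, `z' ↦ f (z', sheet z')` is holomorphic. [folklore] -/
theorem differentiableOn_comp_sheet (hS : CoverSetup f a' a'' ε r C F rr RR) {B : Set E'}
    {s : Fin (m + 1) → ℕ} {β : ∀ i, Fin (s i) → E' → ℂ} (hSh : Sheets F a'' rr B s β)
    (hB : B ⊆ ball a' ε) (J : ∀ i, Fin (s i)) :
    DifferentiableOn ℂ (fun z' => f (z', sheet β J z')) B :=
  hS.differentiableOn.comp (differentiableOn_id.prodMk (hSh.differentiableOn_sheet J))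
    fun z' hz' => mk_mem_prod (hB hz') (hS.mem_ball_of_mem_box fun i => hSh.mem_ball z' hz' i (J i))

/-! ### Full sheets -/

/-- `Full x`: near `x`, every point of the root boxes is a zero of `f` ("the sheet through `x` is
contained in the zero set near `x`"). A canonical, local property, constant along sheets over
balls (`full_sheet_iff`). [folklore] -/
def Full (f : E' × (Fin (m + 1) → ℂ) → (Fin N → ℂ)) (a' : E') (ε : ℝ)
    (F : Fin (m + 1) → E' × ℂ → ℂ) (a'' : Fin (m + 1) → ℂ) (rr : Fin (m + 1) → ℝ)
    (x : E' × (Fin (m + 1) → ℂ)) : Prop :=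
  ∃ V ∈ 𝓝 x, ∀ y ∈ V, y.1 ∈ ball a' ε → y.2 ∈ rootBox F a'' rr y.1 → f y = 0

/-- **Fullness along a sheet is vanishing of `f` along the sheet near the base point.**
[folklore] -/
theorem full_sheet_iff_eventually (_hS : CoverSetup f a' a'' ε r C F rr RR) {B : Set E'}
    (hBo : IsOpen B) (hB : B ⊆ ball a' ε) {s : Fin (m + 1) → ℕ} {β : ∀ i, Fin (s i) → E' → ℂ}
    (hSh : Sheets F a'' rr B s β) (J : ∀ i, Fin (s i)) {z' : E'} (hz' : z' ∈ B) :
    Full f a' ε F a'' rr (z', sheet β J z') ↔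
      ∀ᶠ z'' in 𝓝 z', f (z'', sheet β J z'') = 0 := by
  have hcont : ContinuousAt (fun z'' => ((z'', sheet β J z'') : E' × (Fin (m + 1) → ℂ))) z' :=
    ((continuousOn_id.prodMk (hSh.differentiableOn_sheet J).continuousOn).continuousAt
      (hBo.mem_nhds hz'))
  constructor
  · rintro ⟨V, hV, hVf⟩
    filter_upwards [hcont.preimage_mem_nhds hV, hBo.mem_nhds hz'] with z'' hz''V hz''B
    exact hVf _ hz''V (hB hz''B) (hSh.sheet_mem_rootBox hz''B J)
  · intro h
    -- an open ball `B'` around `z'` inside `B` on which `f (z'', sheet J z'') = 0`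
    obtain ⟨δ, hδ, hδB⟩ : ∃ δ > 0, ball z' δ ⊆ B ∩ {z'' | f (z'', sheet β J z'') = 0} :=
      Metric.mem_nhds_iff.1 (Filter.inter_mem (hBo.mem_nhds hz') h)
    -- the neighbourhood: base in `B'`, fibre away from the other sheets
    set V : Set (E' × (Fin (m + 1) → ℂ)) := (ball z' δ ×ˢ univ) ∩
      ⋂ J' ∈ (Finset.univ.erase J), {y | y.1 ∈ B ∧ y.2 ≠ sheet β J' y.1} with hV
    have hVo : IsOpen V := by
      refine (isOpen_ball.prod isOpen_univ).inter (isOpen_biInter_finset fun J' _ => ?_)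
      have hc : ContinuousOn (fun y : E' × (Fin (m + 1) → ℂ) => y.2 - sheet β J' y.1)
          (B ×ˢ univ) :=
        continuousOn_snd.sub ((hSh.differentiableOn_sheet J').continuousOn.comp continuousOn_fst
          fun y hy => hy.1)
      have := hc.isOpen_inter_preimage (t := {(0 : Fin (m + 1) → ℂ)}ᶜ) (hBo.prod isOpen_univ)
        isOpen_compl_singleton
      convert this using 1
      ext y
      simp only [mem_setOf_eq, mem_inter_iff, mem_prod, mem_univ, and_true, mem_preimage,
        mem_compl_iff, mem_singleton_iff, sub_eq_zero]
    have hxV : (z', sheet β J z') ∈ V := by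
      refine ⟨mk_mem_prod (mem_ball_self hδ) (mem_univ _), mem_iInter₂.2 fun J' hJ' => ⟨hz', ?_⟩⟩
      exact fun h => (Finset.mem_erase.1 hJ').1 (hSh.sheet_injective hz' h.symm)
    refine ⟨V, hVo.mem_nhds hxV, fun y hyV _ hyw => ?_⟩
    have hy1 : y.1 ∈ ball z' δ := hyV.1.1
    have hy1B : y.1 ∈ B := (hδB hy1).1
    obtain ⟨J', hJ'⟩ := (hSh.mem_rootBox_iff_sheet hy1B).1 hyw
    have hJJ' : J' = J := by
      by_contra hne
      have := (mem_iInter₂.1 hyV.2) J' (Finset.mem_erase.2 ⟨hne, Finset.mem_univ _⟩)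
      exact this.2 hJ'
    subst hJJ'
    have : y = (y.1, sheet β J' y.1) := Prod.ext rfl hJ'
    rw [this]
    exact (hδB hy1).2

/-- **Fullness propagates along sheets over balls** (identity theorem): if the sheet `J` is full at
one point of the ball `B`, then `f` vanishes along it over all of `B`. [folklore] -/
theorem eqOn_zero_of_full (hS : CoverSetup f a' a'' ε r C F rr RR) {z₀ : E'} {δ : ℝ}
    (hB : ball z₀ δ ⊆ ball a' ε) {s : Fin (m + 1) → ℕ} {β : ∀ i, Fin (s i) → E' → ℂ}
    (hSh : Sheets F a'' rr (ball z₀ δ) s β) (J : ∀ i, Fin (s i)) {z₁ : E'} (hz₁ : z₁ ∈ ball z₀ δ)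
    (hfull : Full f a' ε F a'' rr (z₁, sheet β J z₁)) :
    ∀ z' ∈ ball z₀ δ, f (z', sheet β J z') = 0 := by
  have h := (hS.full_sheet_iff_eventually isOpen_ball hB hSh J hz₁).1 hfull
  exact eqOn_zero_of_preconnected_of_eventuallyEq_zero (hS.differentiableOn_comp_sheet hSh hB J)
    isOpen_ball (convex_ball _ _).isPreconnected hz₁ h

/-- Fullness is constant along sheets over balls. [folklore] -/
theorem full_sheet_iff (hS : CoverSetup f a' a'' ε r C F rr RR) {z₀ : E'} {δ : ℝ}
    (hB : ball z₀ δ ⊆ ball a' ε) {s : Fin (m + 1) → ℕ} {β : ∀ i, Fin (s i) → E' → ℂ}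
    (hSh : Sheets F a'' rr (ball z₀ δ) s β) (J : ∀ i, Fin (s i)) {z₁ z₂ : E'}
    (hz₁ : z₁ ∈ ball z₀ δ) (hz₂ : z₂ ∈ ball z₀ δ) :
    Full f a' ε F a'' rr (z₁, sheet β J z₁) ↔ Full f a' ε F a'' rr (z₂, sheet β J z₂) := by
  constructor <;> intro h
  · exact (hS.full_sheet_iff_eventually isOpen_ball hB hSh J hz₂).2
      (Filter.eventually_of_mem (isOpen_ball.mem_nhds hz₂) (hS.eqOn_zero_of_full hB hSh J hz₁ h))
  · exact (hS.full_sheet_iff_eventually isOpen_ball hB hSh J hz₁).2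
      (Filter.eventually_of_mem (isOpen_ball.mem_nhds hz₁) (hS.eqOn_zero_of_full hB hSh J hz₂ h))

/-- A non-full sheet is nowhere identically zero over the ball. [folklore] -/
theorem not_eventuallyEq_of_not_full (hS : CoverSetup f a' a'' ε r C F rr RR) {z₀ : E'} {δ : ℝ}
    (hB : ball z₀ δ ⊆ ball a' ε) {s : Fin (m + 1) → ℕ} {β : ∀ i, Fin (s i) → E' → ℂ}
    (hSh : Sheets F a'' rr (ball z₀ δ) s β) (J : ∀ i, Fin (s i)) {z₁ : E'} (hz₁ : z₁ ∈ ball z₀ δ)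
    (hnf : ¬ Full f a' ε F a'' rr (z₁, sheet β J z₁)) {z' : E'} (hz' : z' ∈ ball z₀ δ) :
    ¬ (fun z'' => f (z'', sheet β J z'')) =ᶠ[𝓝 z'] 0 := fun h =>
  hnf ((hS.full_sheet_iff hB hSh J hz' hz₁).1 ((hS.full_sheet_iff_eventually isOpen_ball hB hSh J hz').2 h))

/-! ### The norms over the non-full points and the function `Δ` -/

open Classical in
/-- The **norm** `N_t (z') = ∏ Σ_l t^l f_l (z', w)` over the non-full points `w` of the root box
over `z'`. [Chirka, *Complex Analytic Sets*, §4.2 (canonical defining functions)] [folklore] -/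
noncomputable def normFn (f : E' × (Fin (m + 1) → ℂ) → (Fin N → ℂ)) (a' : E') (ε : ℝ)
    (F : Fin (m + 1) → E' × ℂ → ℂ) (a'' : Fin (m + 1) → ℂ) (rr : Fin (m + 1) → ℝ) (t : ℂ)
    (z' : E') : ℂ :=
  ∏ w ∈ (rootBox F a'' rr z').filter (fun w => ¬ Full f a' ε F a'' rr (z', w)),
    ∑ l : Fin N, t ^ (l : ℕ) * f (z', w) l

open Classical in
/-- **Local formula for the norms over a sheet ball**: a product over the non-full sheets.
[folklore] -/
theorem normFn_eq_prod_sheets (hS : CoverSetup f a' a'' ε r C F rr RR) {z₀ : E'} {δ : ℝ}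
    (hB : ball z₀ δ ⊆ ball a' ε) {s : Fin (m + 1) → ℕ} {β : ∀ i, Fin (s i) → E' → ℂ}
    (hSh : Sheets F a'' rr (ball z₀ δ) s β) {z₁ : E'} (hz₁ : z₁ ∈ ball z₀ δ) (t : ℂ) {z' : E'}
    (hz' : z' ∈ ball z₀ δ) :
    normFn f a' ε F a'' rr t z' =
      ∏ J ∈ Finset.univ.filter (fun J => ¬ Full f a' ε F a'' rr (z₁, sheet β J z₁)),
        ∑ l : Fin N, t ^ (l : ℕ) * f (z', sheet β J z') l := by
  classical
  unfold normFn
  rw [hSh.rootBox_eq_image hz', Finset.filter_image, Finset.prod_image]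
  · refine Finset.prod_congr ?_ fun _ _ => rfl
    ext J
    simp only [Finset.mem_filter, Finset.mem_univ, true_and]
    exact not_congr (hS.full_sheet_iff hB hSh J hz' hz₁)
  · intro J _ J' _ h
    exact hSh.sheet_injective hz' h

open Classical in
/-- The norms are holomorphic on sheet balls. [folklore] -/
theorem differentiableOn_normFn (hS : CoverSetup f a' a'' ε r C F rr RR) {z₀ : E'} {δ : ℝ}
    (hB : ball z₀ δ ⊆ ball a' ε) {s : Fin (m + 1) → ℕ} {β : ∀ i, Fin (s i) → E' → ℂ}
    (hSh : Sheets F a'' rr (ball z₀ δ) s β) (t : ℂ) :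
    DifferentiableOn ℂ (normFn f a' ε F a'' rr t) (ball z₀ δ) := by
  by_cases hne : (ball z₀ δ).Nonempty
  · obtain ⟨z₁, hz₁⟩ := hne
    have heq : EqOn (fun z' => ∏ J ∈ Finset.univ.filter
        (fun J => ¬ Full f a' ε F a'' rr (z₁, sheet β J z₁)),
          ∑ l : Fin N, t ^ (l : ℕ) * f (z', sheet β J z') l) (normFn f a' ε F a'' rr t)
        (ball z₀ δ) := fun z' hz' => (hS.normFn_eq_prod_sheets hB hSh hz₁ t hz').symm
    refine DifferentiableOn.congr ?_ fun z' hz' => (heq hz').symm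
    exact Literature.Analysis.Complex.SCV.differentiableOn_finset_prod _ fun J _ => DifferentiableOn.fun_sum fun l _ =>
      ((differentiableOn_pi.1 (hS.differentiableOn_comp_sheet hSh hB J) l).const_mul _)
  · rw [not_nonempty_iff_eq_empty] at hne
    rw [hne]; exact differentiableOn_empty

/-- **The norms are bounded** on the base ball (the root boxes lie in the polydisc where
`‖f‖ ≤ C`, and have at most `K` points). [folklore] -/
theorem norm_normFn_le (hS : CoverSetup f a' a'' ε r C F rr RR) (t : ℂ) {z' : E'}
    (hz' : z' ∈ ball a' ε) :
    ‖normFn f a' ε F a'' rr t z'‖ ≤ (max 1 (∑ l : Fin N, ‖t‖ ^ (l : ℕ) * max C 0)) ^ hS.boxBound := by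
  classical
  unfold normFn
  rw [norm_prod]
  set Mt := max 1 (∑ l : Fin N, ‖t‖ ^ (l : ℕ) * max C 0) with hMt
  set D := (rootBox F a'' rr z').filter (fun w => ¬ Full f a' ε F a'' rr (z', w)) with hD
  have h1 : ∀ w ∈ D, ‖∑ l : Fin N, t ^ (l : ℕ) * f (z', w) l‖ ≤ Mt := by
    intro w hw
    have hwB : w ∈ rootBox F a'' rr z' := (Finset.mem_filter.1 hw).1
    refine le_trans ?_ (le_max_right _ _)
    refine (norm_sum_le _ _).trans (Finset.sum_le_sum fun l _ => ?_)
    rw [norm_mul, norm_pow]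
    exact mul_le_mul_of_nonneg_left (hS.norm_apply_le hz' hwB l) (by positivity)
  calc ∏ w ∈ D, ‖∑ l : Fin N, t ^ (l : ℕ) * f (z', w) l‖ ≤ ∏ w ∈ D, Mt :=
        Finset.prod_le_prod (fun _ _ => norm_nonneg _) h1
    _ = Mt ^ D.card := Finset.prod_const Mt
    _ ≤ Mt ^ hS.boxBound := pow_le_pow_right₀ (le_max_left _ _)
        ((Finset.card_filter_le _ _).trans (hS.card_rootBox_le hz'))

/-- **The analytic cover structure off `{Δ = 0}`** (Chirka §3.7 Thm., in the weak form needed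
for §5.1: the critical set is only shown to lie in the zero set of a holomorphic `Δ ≢ 0`, not to be
analytic). In the set-up `CoverSetup`, there is a holomorphic function `Δ` on the base ball,
vanishing identically near no point, such that over a neighbourhood of every point `z₀` with
`Δ z₀ ≠ 0` the zero set of `f` in the closed polydisc is the disjoint union of the graphs of
finitely many holomorphic maps into the box. Construction: `Δ = (∏_i μ_i) · Ñ_{t*}` with `μ_i`
the Hankel discriminants of the shadow functions and `Ñ_{t*}` the Riemann extension
(`exists_differentiableOn_eqOn_of_thin`) of a norm `normFn` over the non-full points of the root
boxes, `t*` chosen by the norm trick (`prod_sum_pow_mul_eq_zero_iff`) at a common non-zero point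
of the non-full sheets (`exists_forall_ne_zero_of_not_eventuallyEq`).
[cite: Chirka1989, §3.7 Thm.; §4.1 (p. 42)] -/
theorem exists_cover_structure (hS : CoverSetup f a' a'' ε r C F rr RR) :
    ∃ Δ : E' → ℂ, DifferentiableOn ℂ Δ (ball a' ε) ∧ (∀ z' ∈ ball a' ε, ¬ Δ =ᶠ[𝓝 z'] 0) ∧
      ∀ z₀ ∈ ball a' ε, Δ z₀ ≠ 0 → ∃ δ > 0, ball z₀ δ ⊆ ball a' ε ∧
        ∃ (n : ℕ) (σ : Fin n → E' → (Fin (m + 1) → ℂ)),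
          (∀ j, DifferentiableOn ℂ (σ j) (ball z₀ δ)) ∧
          (∀ z' ∈ ball z₀ δ, ∀ j j', j ≠ j' → σ j z' ≠ σ j' z') ∧
          (∀ z' ∈ ball z₀ δ, ∀ j i, σ j z' i ∈ ball (a'' i) (rr i)) ∧
          ∀ z' ∈ ball z₀ δ, ∀ w ∈ closedBall a'' r, f (z', w) = 0 ↔ ∃ j, w = σ j z' := by
  classical
  obtain ⟨μ, hμd, hμne, hsheets⟩ := hS.exists_disc
  -- the product of the discriminants and the good set `G₀`
  set Pμ : E' → ℂ := fun z' => ∏ i, μ i z' with hPμ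
  have hPμd : DifferentiableOn ℂ Pμ (ball a' ε) := Literature.Analysis.Complex.SCV.differentiableOn_finset_prod _ fun i _ => hμd i
  have hμnz : ∀ i, ∀ z ∈ ball a' ε, ¬ μ i =ᶠ[𝓝 z] 0 := by
    intro i z hz h
    obtain ⟨z₁, hz₁, hne⟩ := hμne i
    exact hne (eqOn_zero_of_preconnected_of_eventuallyEq_zero (hμd i) isOpen_ball
      (convex_ball _ _).isPreconnected hz h hz₁)
  obtain ⟨z₀, hz₀, hz₀ne⟩ := exists_forall_ne_zero_of_not_eventuallyEq Finset.univ isOpen_ball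
    ⟨a', mem_ball_self hS.ε_pos⟩ (fun i _ => (hμd i).continuousOn) (fun i _ => hμnz i)
  have hPμ0 : Pμ z₀ ≠ 0 := Finset.prod_ne_zero_iff.2 fun i _ => hz₀ne i (Finset.mem_univ i)
  have hPμnz : ∀ z ∈ ball a' ε, ¬ Pμ =ᶠ[𝓝 z] 0 := fun z hz h =>
    hPμ0 (eqOn_zero_of_preconnected_of_eventuallyEq_zero hPμd isOpen_ball
      (convex_ball _ _).isPreconnected hz h hz₀)
  set G₀ : Set E' := ball a' ε ∩ Pμ ⁻¹' {0}ᶜ with hG₀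
  have hG₀o : IsOpen G₀ :=
    hPμd.continuousOn.isOpen_inter_preimage isOpen_ball isOpen_compl_singleton
  have hG₀μ : ∀ z' ∈ G₀, ∀ i, μ i z' ≠ 0 := fun z' hz' i =>
    (Finset.prod_ne_zero_iff.1 hz'.2) i (Finset.mem_univ i)
  -- holomorphy of the norms on `G₀`
  have hNd : ∀ t, DifferentiableOn ℂ (normFn f a' ε F a'' rr t) G₀ := by
    intro t z' hz'
    obtain ⟨δ, hδ, hδsub, s, β, hSh⟩ := hsheets z' hz'.1 (hG₀μ z' hz')
    exact ((hS.differentiableOn_normFn hδsub hSh t).differentiableAt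
      (isOpen_ball.mem_nhds (mem_ball_self hδ))).differentiableWithinAt
  -- Riemann extension of the norms across `{Pμ = 0}`
  have hUA : ball a' ε \ Pμ ⁻¹' {0} = G₀ := by
    ext z'; simp [hG₀]
  have hext : ∀ t, ∃ g : E' → ℂ, DifferentiableOn ℂ g (ball a' ε) ∧
      EqOn g (normFn f a' ε F a'' rr t) G₀ := by
    intro t
    have h := exists_differentiableOn_eqOn_of_thin (f := normFn f a' ε F a'' rr t)
      (U := ball a' ε) (A := Pμ ⁻¹' {0}) (by rw [hUA]; exact hG₀o)
      (fun x hx => ⟨Pμ, ball a' ε, isOpen_ball, hx.2, Subset.rfl, hPμd, fun y hy => hy.1,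
        hPμnz x hx.2⟩)
      (by rw [hUA]; exact hNd t)
      (fun x hx => ⟨ball a' ε, isOpen_ball.mem_nhds hx.2, _, fun y hy => hS.norm_normFn_le t hy.1⟩)
    rw [hUA] at h
    exact h
  choose Nn hNnd hNneq using hext
  -- the number of values of `t`
  set T := hS.boxBound * (N - 1) + 1 with hT
  -- Claim A: all norms vanish at `z'` iff some non-full point of the root box is a zero
  have claimA : ∀ z' ∈ ball a' ε, (∀ i : Fin T, normFn f a' ε F a'' rr ((i : ℕ) : ℂ) z' = 0) ↔
      ∃ w ∈ rootBox F a'' rr z', ¬ Full f a' ε F a'' rr (z', w) ∧ f (z', w) = 0 := by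
    intro z' hz'
    have h := prod_sum_pow_mul_eq_zero_iff
      (D := (rootBox F a'' rr z').filter fun w => ¬ Full f a' ε F a'' rr (z', w))
      ((Finset.card_filter_le _ _).trans (hS.card_rootBox_le hz')) (fun w => f (z', w))
    unfold normFn
    rw [h]
    simp only [Finset.mem_filter]
    constructor
    · rintro ⟨w, ⟨hw, hnf⟩, h0⟩; exact ⟨w, hw, hnf, h0⟩
    · rintro ⟨w, hw, hnf, h0⟩; exact ⟨w, ⟨hw, hnf⟩, h0⟩
  -- Claim B: some norm is nonzero somewhere on `G₀`
  obtain ⟨z₁, hz₁G, i₀, hi₀⟩ : ∃ z₁ ∈ G₀, ∃ i₀ : Fin T,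
      normFn f a' ε F a'' rr ((i₀ : ℕ) : ℂ) z₁ ≠ 0 := by
    obtain ⟨δ, hδ, hδsub, s, β, hSh⟩ := hsheets z₀ hz₀ (fun i => hz₀ne i (Finset.mem_univ i))
    set I := Finset.univ.filter fun J : (∀ i, Fin (s i)) =>
      ¬ Full f a' ε F a'' rr (z₀, sheet β J z₀) with hI
    have hz₀G : z₀ ∈ G₀ := ⟨hz₀, hPμ0⟩
    obtain ⟨z₁, hz₁, hz₁ne⟩ := exists_forall_ne_zero_of_not_eventuallyEq I
      (hG₀o.inter isOpen_ball) ⟨z₀, hz₀G, mem_ball_self hδ⟩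
      (fun J _ => (hS.differentiableOn_comp_sheet hSh hδsub J).continuousOn.mono
        inter_subset_right)
      (fun J hJ z hz => hS.not_eventuallyEq_of_not_full hδsub hSh J (mem_ball_self hδ)
        (Finset.mem_filter.1 hJ).2 hz.2)
    refine ⟨z₁, hz₁.1, ?_⟩
    by_contra hall
    simp only [not_exists, not_not] at hall
    obtain ⟨w, hw, hnf, h0⟩ := (claimA z₁ hz₁.1.1).1 hall
    obtain ⟨J, rfl⟩ := (hSh.mem_rootBox_iff_sheet hz₁.2).1 hw
    have hJI : J ∈ I := Finset.mem_filter.2 ⟨Finset.mem_univ _, fun h =>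
      hnf ((hS.full_sheet_iff hδsub hSh J (mem_ball_self hδ) hz₁.2).1 h)⟩
    exact hz₁ne J hJI h0
  -- the function `Δ`
  set Δ : E' → ℂ := fun z' => Pμ z' * Nn ((i₀ : ℕ) : ℂ) z' with hΔ
  have hΔd : DifferentiableOn ℂ Δ (ball a' ε) := hPμd.mul (hNnd _)
  have hΔ1 : Δ z₁ ≠ 0 := mul_ne_zero hz₁G.2 (by rw [hNneq _ hz₁G]; exact hi₀)
  have hΔnz : ∀ z ∈ ball a' ε, ¬ Δ =ᶠ[𝓝 z] 0 := fun z hz h =>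
    hΔ1 (eqOn_zero_of_preconnected_of_eventuallyEq_zero hΔd isOpen_ball
      (convex_ball _ _).isPreconnected hz h hz₁G.1)
  refine ⟨Δ, hΔd, hΔnz, fun zc hzc hΔzc => ?_⟩
  -- sheets around `zc`, on a ball where `Δ ≠ 0`
  have hzcG : zc ∈ G₀ := ⟨hzc, left_ne_zero_of_mul hΔzc⟩
  obtain ⟨δ, hδ, hδsub, s, β, hSh⟩ := hsheets zc hzc (hG₀μ zc hzcG)
  obtain ⟨δ', hδ', hδ'sub⟩ : ∃ δ' > 0, ball zc δ' ⊆ ball zc δ ∩ (ball a' ε ∩ Δ ⁻¹' {0}ᶜ) := by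
    have h1 : ball a' ε ∩ Δ ⁻¹' {0}ᶜ ∈ 𝓝 zc :=
      (hΔd.continuousOn.isOpen_inter_preimage isOpen_ball isOpen_compl_singleton).mem_nhds
        ⟨hzc, hΔzc⟩
    exact Metric.mem_nhds_iff.1 (Filter.inter_mem (isOpen_ball.mem_nhds (mem_ball_self hδ)) h1)
  have hB'sub : ball zc δ' ⊆ ball zc δ := fun z hz => (hδ'sub hz).1
  have hSh' : Sheets F a'' rr (ball zc δ') s β := hSh.mono hB'sub
  -- full sheets vanish identically; non-full sheets have no zeros over `ball zc δ'`
  set P : (∀ i, Fin (s i)) → Prop := fun J => Full f a' ε F a'' rr (zc, sheet β J zc) with hP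
  have hfull : ∀ J, P J → ∀ z' ∈ ball zc δ, f (z', sheet β J z') = 0 := fun J hJ =>
    hS.eqOn_zero_of_full hδsub hSh J (mem_ball_self hδ) hJ
  have hnonfull : ∀ J, ¬ P J → ∀ z' ∈ ball zc δ', f (z', sheet β J z') ≠ 0 := by
    intro J hJ z' hz' h0
    have hz'ε : z' ∈ ball a' ε := (hδ'sub hz').2.1
    have hΔz' : Δ z' ≠ 0 := (hδ'sub hz').2.2
    have hz'G : z' ∈ G₀ := ⟨hz'ε, left_ne_zero_of_mul hΔz'⟩
    have hnf : ¬ Full f a' ε F a'' rr (z', sheet β J z') := fun h =>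
      hJ ((hS.full_sheet_iff hδsub hSh J (hB'sub hz') (mem_ball_self hδ)).1 h)
    have hall : ∀ i : Fin T, normFn f a' ε F a'' rr ((i : ℕ) : ℂ) z' = 0 :=
      (claimA z' hz'ε).2 ⟨_, hSh.sheet_mem_rootBox (hB'sub hz') J, hnf, h0⟩
    apply hΔz'
    show Pμ z' * Nn _ z' = 0
    rw [hNneq _ hz'G, hall i₀, mul_zero]
  -- enumerate the full sheets
  set Sfull := Finset.univ.filter P with hSfull
  set e := Sfull.equivFin with he
  refine ⟨δ', hδ', fun z hz => (hδ'sub hz).2.1, Sfull.card,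
    fun j => sheet β (e.symm j : ∀ i, Fin (s i)), fun j => hSh'.differentiableOn_sheet _,
    fun z' hz' j j' hjj h => hjj (e.symm.injective (Subtype.ext (hSh'.sheet_injective hz' h))),
    fun z' hz' j i => hSh'.mem_ball z' hz' i _, fun z' hz' w hw => ?_⟩
  constructor
  · intro h0
    have hwB : w ∈ rootBox F a'' rr z' :=
      hS.mem_rootBox_of_zero (x := (z', w)) (mk_mem_prod (hδ'sub hz').2.1 hw) h0
    obtain ⟨J, rfl⟩ := (hSh'.mem_rootBox_iff_sheet hz').1 hwB
    have hPJ : P J := by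
      by_contra hPJ
      exact hnonfull J hPJ z' hz' h0
    refine ⟨e ⟨J, Finset.mem_filter.2 ⟨Finset.mem_univ _, hPJ⟩⟩, ?_⟩
    simp only [Equiv.symm_apply_apply]
  · rintro ⟨j, rfl⟩
    exact hfull _ (Finset.mem_filter.1 (e.symm j).2).2 z' (hB'sub hz')

end CoverSetup

end Cover

/-! ## Closures of unions of sheets of an analytic cover are analytic (Chirka §4.2–4.3, lite) -/

section CoverClosure

variable {E' : Type*} [NormedAddCommGroup E'] [NormedSpace ℂ E'] {n : ℕ}

/-- The **moment functionals** `ζ_t (v) = Σ_i t^i v_i` on `ℂⁿ`: for `n` distinct values of `t`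
they have no common zero `v ≠ 0` (Vandermonde, `eq_zero_of_sum_pow_mul_eq_zero`), so that
`K (n - 1) + 1` of them separate any `K` nonzero vectors from `0` (`prod_sum_pow_mul_eq_zero_iff`).
[folklore] -/
def momentFn (n : ℕ) (t : ℂ) (v : Fin n → ℂ) : ℂ :=
  ∑ i : Fin n, t ^ (i : ℕ) * v i

omit [NormedSpace ℂ E'] in
/-- `(z', w) ↦ ζ_t (w - τ z')` is continuous in the data. [folklore] -/
theorem momentFn_sub_apply (t : ℂ) (w b : Fin n → ℂ) :
    momentFn n t (w - b) = ∑ i : Fin n, t ^ (i : ℕ) * (w i - b i) := by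
  simp [momentFn]

/-- Bound for the moment functionals: `|ζ_t (v)| ≤ Σ_i |t|^i ‖v‖`. [folklore] -/
theorem norm_momentFn_le (t : ℂ) (v : Fin n → ℂ) :
    ‖momentFn n t v‖ ≤ (∑ i : Fin n, ‖t‖ ^ (i : ℕ)) * ‖v‖ := by
  unfold momentFn
  rw [Finset.sum_mul]
  refine (norm_sum_le _ _).trans (Finset.sum_le_sum fun i _ => ?_)
  rw [norm_mul, norm_pow]
  exact mul_le_mul_of_nonneg_left (norm_le_pi_norm v i) (by positivity)

/-- **A piece of an analytic cover.** `S ⊆ E' × ℂⁿ` lies over the open subset `G` of the open set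
`V'` of the base, whose complement `V' ∖ G` is *thin* (locally in the zero set of a holomorphic
function not vanishing identically); the fibre coordinates of `S` are bounded by `R`; and over a
neighbourhood of each point of `G`, `S` is the union of the graphs of at most `K` holomorphic maps
with pairwise distinct values. (E.g. a union of connected components of the unramified part of a
local analytic cover, `CoverSetup.exists_cover_structure`.)
[Chirka, *Complex Analytic Sets*, §4.1 (analytic covers), §4.2] [folklore] -/
structure CoverPiece (S : Set (E' × (Fin n → ℂ))) (V' G : Set E') (K : ℕ) (R : ℝ) : Prop where
  isOpen_base : IsOpen V'
  isOpen : IsOpen G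
  subset : G ⊆ V'
  thin : ∀ z ∈ V' \ G, ∃ (φ : E' → ℂ) (W : Set E'), IsOpen W ∧ z ∈ W ∧ W ⊆ V' ∧
    DifferentiableOn ℂ φ W ∧ (∀ x ∈ (V' \ G) ∩ W, φ x = 0) ∧ ¬ φ =ᶠ[𝓝 z] 0
  fst_mem : ∀ x ∈ S, x.1 ∈ G
  norm_le : ∀ x ∈ S, ‖x.2‖ ≤ R
  sheets : ∀ z₀ ∈ G, ∃ δ > 0, ball z₀ δ ⊆ G ∧ ∃ (k : ℕ) (τ : Fin k → E' → (Fin n → ℂ)),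
    k ≤ K ∧ (∀ j, DifferentiableOn ℂ (τ j) (ball z₀ δ)) ∧
    (∀ z' ∈ ball z₀ δ, ∀ j j', j ≠ j' → τ j z' ≠ τ j' z') ∧
    ∀ z' ∈ ball z₀ δ, ∀ w, (z', w) ∈ S ↔ ∃ j, w = τ j z'

namespace CoverPiece

variable {S : Set (E' × (Fin n → ℂ))} {V' G : Set E'} {K : ℕ} {R : ℝ}

/-- The fibres of a cover piece are finite. [folklore] -/
theorem finite_fibre (h : CoverPiece S V' G K R) {z' : E'} (hz' : z' ∈ G) :
    {w | (z', w) ∈ S}.Finite := by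
  obtain ⟨δ, hδ, -, k, τ, -, -, -, hiff⟩ := h.sheets z' hz'
  refine (Set.finite_range fun j : Fin k => τ j z').subset fun w hw => ?_
  obtain ⟨j, rfl⟩ := (hiff z' (mem_ball_self hδ) w).1 hw
  exact ⟨j, rfl⟩

open Classical in
/-- The fibre of the cover piece over `z'` as a finite set (empty off `G`). [folklore] -/
noncomputable def fibre (h : CoverPiece S V' G K R) (z' : E') : Finset (Fin n → ℂ) :=
  if hz' : z' ∈ G then (h.finite_fibre hz').toFinset else ∅

/-- Membership in the fibre finset. [folklore] -/
theorem mem_fibre (h : CoverPiece S V' G K R) {z' : E'} (hz' : z' ∈ G) {w : Fin n → ℂ} :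
    w ∈ h.fibre z' ↔ (z', w) ∈ S := by
  classical
  simp [fibre, hz', Set.Finite.mem_toFinset]

/-- Over a sheet ball the fibre is the set of values of the sheets. [folklore] -/
theorem fibre_eq_image (h : CoverPiece S V' G K R) {z₀ : E'} {δ : ℝ} (hB : ball z₀ δ ⊆ G)
    {k : ℕ} {τ : Fin k → E' → (Fin n → ℂ)}
    (hiff : ∀ z' ∈ ball z₀ δ, ∀ w, (z', w) ∈ S ↔ ∃ j, w = τ j z') {z' : E'}
    (hz' : z' ∈ ball z₀ δ) : h.fibre z' = Finset.univ.image fun j => τ j z' := by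
  classical
  ext w
  rw [h.mem_fibre (hB hz'), hiff z' hz', Finset.mem_image]
  constructor
  · rintro ⟨j, rfl⟩; exact ⟨j, Finset.mem_univ _, rfl⟩
  · rintro ⟨j, -, rfl⟩; exact ⟨j, rfl⟩

/-- The fibres have at most `K` points. [folklore] -/
theorem card_fibre_le (h : CoverPiece S V' G K R) (z' : E') : (h.fibre z').card ≤ K := by
  classical
  by_cases hz' : z' ∈ G
  · obtain ⟨δ, hδ, hδG, k, τ, hk, -, -, hiff⟩ := h.sheets z' hz'
    rw [h.fibre_eq_image hδG hiff (mem_ball_self hδ)]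
    exact (Finset.card_image_le.trans (by simp)).trans hk
  · simp [fibre, hz']

/-- Points of the fibres are bounded by `R`. [folklore] -/
theorem norm_le_of_mem_fibre (h : CoverPiece S V' G K R) {z' : E'} {w : Fin n → ℂ}
    (hw : w ∈ h.fibre z') : ‖w‖ ≤ R := by
  classical
  by_cases hz' : z' ∈ G
  · exact h.norm_le (z', w) ((h.mem_fibre hz').1 hw)
  · simp [fibre, hz'] at hw

/-- **The canonical defining functions** `Φ_t (z', w) = ∏_{b ∈ fibre z'} ζ_t (w - b)` of the
cover piece (a variant of Chirka's canonical defining functions, with the moment functionals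
`ζ_t` in place of all linear functionals). [cite: Chirka1989, §4.2, p. 44–45] -/
noncomputable def defFn (h : CoverPiece S V' G K R) (t : ℂ) (x : E' × (Fin n → ℂ)) : ℂ :=
  ∏ b ∈ h.fibre x.1, momentFn n t (x.2 - b)

/-- Local formula for the defining functions over a sheet ball. [folklore] -/
theorem defFn_eq_prod (h : CoverPiece S V' G K R) {z₀ : E'} {δ : ℝ} (hB : ball z₀ δ ⊆ G)
    {k : ℕ} {τ : Fin k → E' → (Fin n → ℂ)}
    (hne : ∀ z' ∈ ball z₀ δ, ∀ j j', j ≠ j' → τ j z' ≠ τ j' z')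
    (hiff : ∀ z' ∈ ball z₀ δ, ∀ w, (z', w) ∈ S ↔ ∃ j, w = τ j z') (t : ℂ)
    {x : E' × (Fin n → ℂ)} (hx : x.1 ∈ ball z₀ δ) :
    h.defFn t x = ∏ j, momentFn n t (x.2 - τ j x.1) := by
  classical
  unfold defFn
  rw [h.fibre_eq_image hB hiff hx, Finset.prod_image]
  exact fun j _ j' _ hjj => by_contra fun hne' => hne x.1 hx j j' hne' hjj

/-- The defining functions are holomorphic over `G`. [cite: Chirka1989, §4.2, p. 44–45] -/
theorem differentiableOn_defFn (h : CoverPiece S V' G K R) (t : ℂ) :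
    DifferentiableOn ℂ (h.defFn t) (G ×ˢ univ) := by
  intro x hx
  obtain ⟨δ, hδ, hδG, k, τ, -, hτd, hne, hiff⟩ := h.sheets x.1 hx.1
  have hO : IsOpen (ball x.1 δ ×ˢ (univ : Set (Fin n → ℂ))) := isOpen_ball.prod isOpen_univ
  have hxO : x ∈ ball x.1 δ ×ˢ (univ : Set (Fin n → ℂ)) := ⟨mem_ball_self hδ, mem_univ _⟩
  suffices hd : DifferentiableOn ℂ (fun y : E' × (Fin n → ℂ) => ∏ j, momentFn n t (y.2 - τ j y.1))
      (ball x.1 δ ×ˢ univ) by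
    have heq : EqOn (h.defFn t) (fun y => ∏ j, momentFn n t (y.2 - τ j y.1)) (ball x.1 δ ×ˢ univ) :=
      fun y hy => h.defFn_eq_prod hδG hne hiff t hy.1
    exact (((hd.congr fun y hy => (heq hy))).differentiableAt (hO.mem_nhds hxO)).differentiableWithinAt
  refine Literature.Analysis.Complex.SCV.differentiableOn_finset_prod _ fun j _ => ?_
  simp only [momentFn]
  refine DifferentiableOn.fun_sum fun i _ => DifferentiableOn.const_mul ?_ _
  have h1 : DifferentiableOn ℂ (fun y : E' × (Fin n → ℂ) => y.2 i) (ball x.1 δ ×ˢ univ) := by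
    fun_prop
  have h2 : DifferentiableOn ℂ (fun y : E' × (Fin n → ℂ) => τ j y.1 i) (ball x.1 δ ×ˢ univ) :=
    (differentiableOn_pi.1 ((hτd j).comp differentiableOn_fst fun y hy => hy.1) i)
  exact h1.sub h2

/-- Local bound for the defining functions (the fibres are bounded and have at most `K` points).
[folklore] -/
theorem norm_defFn_le (h : CoverPiece S V' G K R) (t : ℂ) (x : E' × (Fin n → ℂ)) :
    ‖h.defFn t x‖ ≤ (max 1 ((∑ i : Fin n, ‖t‖ ^ (i : ℕ)) * (‖x.2‖ + max R 0))) ^ K := by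
  unfold defFn
  rw [norm_prod]
  set M := max 1 ((∑ i : Fin n, ‖t‖ ^ (i : ℕ)) * (‖x.2‖ + max R 0)) with hM
  have h1 : ∀ b ∈ h.fibre x.1, ‖momentFn n t (x.2 - b)‖ ≤ M := by
    intro b hb
    refine (norm_momentFn_le t _).trans (le_trans ?_ (le_max_right _ _))
    refine mul_le_mul_of_nonneg_left ?_ (Finset.sum_nonneg fun i _ => by positivity)
    exact (norm_sub_le _ _).trans (add_le_add le_rfl ((h.norm_le_of_mem_fibre hb).trans
      (le_max_left _ _)))
  calc ∏ b ∈ h.fibre x.1, ‖momentFn n t (x.2 - b)‖ ≤ ∏ b ∈ h.fibre x.1, M :=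
        Finset.prod_le_prod (fun _ _ => norm_nonneg _) h1
    _ = M ^ (h.fibre x.1).card := Finset.prod_const M
    _ ≤ M ^ K := pow_le_pow_right₀ (le_max_left _ _) (h.card_fibre_le x.1)

/-- The defining functions vanish on `S`. [folklore] -/
theorem defFn_eq_zero (h : CoverPiece S V' G K R) (t : ℂ) {x : E' × (Fin n → ℂ)} (hx : x ∈ S) :
    h.defFn t x = 0 := by
  unfold defFn
  refine Finset.prod_eq_zero ((h.mem_fibre (h.fst_mem x hx)).2 (by simpa using hx)) ?_
  simp [momentFn]

/-- **Riemann extension of the defining functions** across the thin set `(V' ∖ G) × ℂⁿ`.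
[cite: Chirka1989, §4.2 Lemma 1, p. 45–46] -/
theorem exists_extension_defFn [CompleteSpace E'] (h : CoverPiece S V' G K R) (t : ℂ) :
    ∃ Φ : E' × (Fin n → ℂ) → ℂ, DifferentiableOn ℂ Φ (V' ×ˢ univ) ∧
      EqOn Φ (h.defFn t) (G ×ˢ univ) := by
  have hUA : (V' ×ˢ (univ : Set (Fin n → ℂ))) \ ((V' \ G) ×ˢ univ) = G ×ˢ univ := by
    ext x
    constructor
    · rintro ⟨⟨hxV, -⟩, hxA⟩
      refine ⟨by_contra fun hxG => hxA ⟨⟨hxV, hxG⟩, mem_univ _⟩, mem_univ _⟩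
    · rintro ⟨hxG, -⟩
      exact ⟨⟨h.subset hxG, mem_univ _⟩, fun hxA => hxA.1.2 hxG⟩
  have := exists_differentiableOn_eqOn_of_thin (f := h.defFn t) (U := V' ×ˢ univ)
    (A := (V' \ G) ×ˢ univ) (by rw [hUA]; exact h.isOpen.prod isOpen_univ) ?_
    (by rw [hUA]; exact h.differentiableOn_defFn t) ?_
  · rw [hUA] at this; exact this
  · -- thinness of `(V' ∖ G) × ℂⁿ`
    rintro x ⟨hxA, -⟩
    obtain ⟨φ, W, hWo, hxW, hWV, hφd, hφ0, hφne⟩ := h.thin x.1 hxA.1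
    refine ⟨fun y => φ y.1, W ×ˢ univ, hWo.prod isOpen_univ, ⟨hxW, mem_univ _⟩,
      prod_mono hWV Subset.rfl, hφd.comp differentiableOn_fst fun y hy => hy.1,
      fun y hy => hφ0 y.1 ⟨hy.1.1, hy.2.1⟩, fun hev => hφne ?_⟩
    have hc : Continuous fun z' : E' => ((z', x.2) : E' × (Fin n → ℂ)) := by fun_prop
    exact (hc.continuousAt.eventually (by exact hev)).mono fun z' hz' => hz'
  · -- local boundedness
    rintro x ⟨-, hxU⟩
    refine ⟨ball x 1, ball_mem_nhds x one_pos,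
      (max 1 ((∑ i : Fin n, ‖t‖ ^ (i : ℕ)) * ((‖x.2‖ + 1) + max R 0))) ^ K, fun y hy => ?_⟩
    refine (h.norm_defFn_le t y).trans (pow_le_pow_left₀ (le_trans zero_le_one (le_max_left _ _))
      (max_le_max le_rfl (mul_le_mul_of_nonneg_left (add_le_add ?_ le_rfl)
        (Finset.sum_nonneg fun i _ => by positivity))) K)
    have hd : dist y.2 x.2 < 1 :=
      lt_of_le_of_lt (by rw [Prod.dist_eq]; exact le_max_right _ _) (mem_ball.1 hy.1)
    calc ‖y.2‖ ≤ ‖x.2‖ + ‖y.2 - x.2‖ := norm_le_insert' _ _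
      _ ≤ ‖x.2‖ + 1 := by rw [← dist_eq_norm]; linarith

/-- The base `V'` lies in the closure of `G` (thin sets are nowhere dense). [folklore] -/
theorem subset_closure (h : CoverPiece S V' G K R) : V' ⊆ closure G := by
  have hVG : V' \ (V' \ G) = G := by
    ext z; constructor
    · rintro ⟨hzV, hz⟩; by_contra hzG; exact hz ⟨hzV, hzG⟩
    · intro hz; exact ⟨h.subset hz, fun hz' => hz'.2 hz⟩
  have := subset_closure_diff_of_thin (U := V') (A := V' \ G) h.isOpen_base fun a ha => h.thin a ha.1
  rwa [hVG] at this

omit [NormedSpace ℂ E'] in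
/-- The moment functionals are continuous. [folklore] -/
theorem continuous_momentFn (t : ℂ) : Continuous (momentFn n t) := by
  unfold momentFn; fun_prop

/-- **Closures of cover pieces are analytic** (Chirka §4.3 Thm., for the pieces needed in §5.1:
the closure in `V' × ℂⁿ` of a union of sheets of the unramified part of an analytic cover is the
common zero set of finitely many functions holomorphic on all of `V' × ℂⁿ`). The equations are the
Riemann extensions `Φ̃_t` of the canonical defining functions `Φ_t = ∏_{b ∈ fibre} ζ_t (w - b)`
for `t = 0, …, K (n - 1)`. If all `Φ̃_t (z'₀, w₀) = 0`, approximate `z'₀` by base points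
`z'_ν ∈ G` with fibres of constant cardinality, extract a convergent subsequence of the (bounded)
fibres, pass to the limit in `Φ_t (z'_ν, w₀) = ∏_j ζ_t (w₀ - b_ν^j)` and conclude by the norm
trick (`prod_sum_pow_mul_eq_zero_iff`) that `w₀` is a limit of fibre points, i.e.
`(z'₀, w₀) ∈ cl S`. [cite: Chirka1989, §4.2 Lemma 1–2, §4.3 Thm., p. 45–47] -/
theorem closure_inter_eq [CompleteSpace E'] (h : CoverPiece S V' G K R) :
    ∃ (M : ℕ) (Φ : E' × (Fin n → ℂ) → (Fin M → ℂ)), DifferentiableOn ℂ Φ (V' ×ˢ univ) ∧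
      closure S ∩ (V' ×ˢ univ) = (V' ×ˢ univ) ∩ Φ ⁻¹' {0} := by
  classical
  choose Φ hΦd hΦeq using fun t => h.exists_extension_defFn t
  set M := K * (n - 1) + 1 with hM
  have hΦS : ∀ t, ∀ y ∈ S, Φ t y = 0 := fun t y hy => by
    rw [hΦeq t ⟨h.fst_mem y hy, mem_univ _⟩]; exact h.defFn_eq_zero t hy
  have hΦc : ∀ t, ∀ x ∈ V' ×ˢ (univ : Set (Fin n → ℂ)), ContinuousAt (Φ t) x := fun t x hx =>
    (hΦd t).continuousOn.continuousAt ((h.isOpen_base.prod isOpen_univ).mem_nhds hx)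
  refine ⟨M, fun x i => Φ ((i : ℕ) : ℂ) x, differentiableOn_pi.2 fun i => hΦd _, ?_⟩
  ext x
  constructor
  · rintro ⟨hxcl, hxV⟩
    refine ⟨hxV, ?_⟩
    rw [mem_preimage, mem_singleton_iff]
    funext i
    have h1 := (hΦc ((i : ℕ) : ℂ) x hxV).continuousWithinAt.mem_closure_image (s := S) hxcl
    have h2 : Φ ((i : ℕ) : ℂ) '' S ⊆ {0} := by
      rintro _ ⟨y, hy, rfl⟩; exact hΦS _ y hy
    have h3 := (closure_mono h2) h1
    rw [closure_singleton] at h3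
    exact h3
  · rintro ⟨hxV, hx0⟩
    refine ⟨?_, hxV⟩
    have hx0' : ∀ i : Fin M, Φ ((i : ℕ) : ℂ) x = 0 := fun i => congrFun hx0 i
    -- base points with fibres of constant cardinality approximating `x.1`
    set Gk : Fin (K + 1) → Set E' := fun k => {z' ∈ G | (h.fibre z').card = k} with hGk
    have hGU : G = ⋃ k, Gk k := by
      ext z'
      simp only [mem_iUnion, hGk, mem_setOf_eq]
      constructor
      · intro hz'
        exact ⟨⟨(h.fibre z').card, Nat.lt_succ_of_le (h.card_fibre_le z')⟩, hz', rfl⟩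
      · rintro ⟨k, hz', -⟩; exact hz'
    obtain ⟨k, hk⟩ : ∃ k : Fin (K + 1), x.1 ∈ closure (Gk k) := by
      have := h.subset_closure hxV.1
      rw [hGU, closure_iUnion_of_finite] at this
      exact mem_iUnion.1 this
    obtain ⟨u, huG, hu⟩ := mem_closure_iff_seq_limit.1 hk
    -- enumerations of the fibres
    have hcard : ∀ ν, (h.fibre (u ν)).card = k := fun ν => (huG ν).2
    set b : ℕ → Fin k → (Fin n → ℂ) := fun ν j =>
      (((h.fibre (u ν)).equivFinOfCardEq (hcard ν)).symm j : Fin n → ℂ) with hb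
    have hbmem : ∀ ν j, b ν j ∈ h.fibre (u ν) := fun ν j =>
      (((h.fibre (u ν)).equivFinOfCardEq (hcard ν)).symm j).2
    have hbS : ∀ ν j, (u ν, b ν j) ∈ S := fun ν j => (h.mem_fibre (huG ν).1).1 (hbmem ν j)
    -- a convergent subsequence of the fibres
    have hbdd : ∀ ν, b ν ∈ closedBall (0 : Fin k → Fin n → ℂ) (max R 0) := fun ν => by
      rw [mem_closedBall, dist_zero_right, pi_norm_le_iff_of_nonneg (le_max_right _ _)]
      exact fun j => (h.norm_le_of_mem_fibre (hbmem ν j)).trans (le_max_left _ _)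
    obtain ⟨β, -, φ, hφ, hbφ⟩ := (isCompact_closedBall _ _).tendsto_subseq hbdd
    -- pass to the limit in the defining functions
    have hlim : ∀ i : Fin M, ∏ j, momentFn n ((i : ℕ) : ℂ) (x.2 - β j) = 0 := by
      intro i
      set t : ℂ := ((i : ℕ) : ℂ) with ht
      -- the values along the subsequence
      have hval : ∀ ν, Φ t (u (φ ν), x.2) = ∏ j, momentFn n t (x.2 - b (φ ν) j) := by
        intro ν
        rw [hΦeq t ⟨(huG (φ ν)).1, mem_univ _⟩]
        unfold defFn
        rw [← Finset.prod_coe_sort, ← ((h.fibre (u (φ ν))).equivFinOfCardEq (hcard (φ ν))).symm.prod_comp]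
      -- limit of the left-hand side
      have hL : Tendsto (fun ν => Φ t (u (φ ν), x.2)) atTop (𝓝 (Φ t x)) := by
        have hy : Tendsto (fun ν => ((u (φ ν), x.2) : E' × (Fin n → ℂ))) atTop (𝓝 x) := by
          have := (hu.comp hφ.tendsto_atTop).prodMk_nhds (tendsto_const_nhds (x := x.2))
          simpa using this
        exact (hΦc t x hxV).tendsto.comp hy
      -- limit of the right-hand side
      have hR : Tendsto (fun ν => ∏ j, momentFn n t (x.2 - b (φ ν) j)) atTop
          (𝓝 (∏ j, momentFn n t (x.2 - β j))) := by
        have hc : Continuous fun c : Fin k → Fin n → ℂ => ∏ j, momentFn n t (x.2 - c j) :=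
          continuous_finsetProd _ fun j _ => (continuous_momentFn t).comp
            (continuous_const.sub (continuous_apply j))
        exact hc.continuousAt.tendsto.comp hbφ
      have := tendsto_nhds_unique (hL.congr hval) hR
      rw [← this]
      exact hx0' i
    -- the norm trick: `x.2` is one of the limit fibre points
    have hkK : (Finset.univ : Finset (Fin k)).card ≤ K := by
      rw [Finset.card_univ, Fintype.card_fin]; exact Nat.le_of_lt_succ k.2
    obtain ⟨j, -, hj⟩ := (prod_sum_pow_mul_eq_zero_iff (K := K)
      (D := (Finset.univ : Finset (Fin k))) hkK (fun j => x.2 - β j)).1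
      (fun i => by simpa [momentFn] using hlim i)
    have hxβ : x.2 = β j := sub_eq_zero.1 hj
    -- points of `S` converging to `x`
    refine mem_closure_of_tendsto (f := fun ν => ((u (φ ν), b (φ ν) j) : E' × (Fin n → ℂ)))
      (b := atTop) ?_ (Filter.Eventually.of_forall fun ν => hbS (φ ν) j)
    have h1 : Tendsto (fun ν => b (φ ν) j) atTop (𝓝 (β j)) :=
      ((continuous_apply j).continuousAt.tendsto.comp hbφ)
    have := (hu.comp hφ.tendsto_atTop).prodMk_nhds h1
    rw [show x = (x.1, β j) from Prod.ext rfl hxβ]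
    simpa using this

end CoverPiece

end CoverClosure

end SCV
end Literature.Analysis.Complex
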